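import Literature.Probability.RandomPlanarGeometry.FlatHulls
import Literature.Probability.RandomPlanarGeometry.HullApproximation
import Literature.Probability.RandomPlanarGeometry.RestrictionMapProofs
import Mathlib.Analysis.Calculus.LocalExtr.Basic
import HarnessLib

/-!
# [LSW] Lemma 2.1 proved: smooth outer approximation of one-sided hulls by the hulls `E_δ`

G. F. Lawler, O. Schramm, W. Werner, *Conformal restriction: the chordal case*, J. Amer. Math.
Soc. **16** (2003) 917–955, arXiv:math/0209343 (**[LSW]**, arXiv page numbers).

[LSW] Lemma 2.1 (p. 8) asserts that every `A ∈ 𝒬₊` is a decreasing limit of smooth hulls, and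
the proof of Lemma 3.5 (p. 13) constructs them: "let `D_δ` be the set of points in `ℍ` with
distance at most `δ` from `[Φ_A(x₀), Φ_A(x₁)]`. Let `E_δ` denote the closure of
`A ∪ Φ_A⁻¹(D_δ)`. It is clear that `E_δ → A` as `δ → 0+` … `∂E_δ ∩ ℍ̄` is a simple path". This
file carries the construction out for one-sided hulls `A` (`Literature.IsSlitHull A p q` of
`HullUniformizer`, slit `[p, q]` on the positive axis) and PROVES the packaged outer
approximation `Literature.HasArcApprox A` of `HullApproximation` — smooth `*`-hulls `J_n ↓ F ⊇ A` with
`F ∩ ℍ ⊆ A`, `0 ∉ F`, and `Φ_{J_n} → Φ_A` uniformly on every `S ⊆ ℍ` with compact closure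
missing `F` — for every nonempty `A ∈ 𝒬₊ ∪ 𝒬₋`:

* `Literature.Probability.RandomPlanarGeometry.IsPlusHull.hasArcApprox'`, `Literature.Probability.RandomPlanarGeometry.IsMinusHull.hasArcApprox'`,
  `Literature.Probability.RandomPlanarGeometry.hasArcApprox_of_plus_or_minus'`,

with NO appeal to the named fact `IsPlusHull.exists_antitone_isArcHull` (which these supersede on
the summit path, see `ConformalRestrictionLeaf`). Here `J_n = E_{δ_n} = D_{δ_n} · A`
(`IsSlitHull.arcHull`, the product hull of `RestrictionSemigroup`) and `F = A ∪ [p, q]`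
(`Literature.filling`).

## Contents

1. `E` on the free real rays (`E` the symmetric extension of `Φ_A`, `HullUniformizer`): no local
   extrema (`E' ≠ 0`), `E(x)/x → 1`, so `E` maps `(-∞, min p q)` onto `(-∞, ℓ₋)` and
   `(max p q, ∞)` onto `(ℓ₊, ∞)` with `0 < ℓ₋ ≤ ℓ₊` (`IsSlitHull.lower`, `IsSlitHull.upper`; for
   `A ∈ 𝒬₊` these are `Φ_A(x₀⁻)… = Φ_A(p⁻)` and `Φ_A(x₁⁺)`).
2. CLUSTER LEMMA `IsSlitHull.mem_realSeg_of_tendsto`: the cluster values of `Φ_A` at the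
   non-free boundary `A ∪ [p, q]` lie in `[ℓ₋, ℓ₊]` (`|F| → 1` by properness of the Riemann map,
   so `im E → 0`; a real cluster value off `[ℓ₋, ℓ₊]` is excluded by the continuous inverse of
   `E`), with a uniform version `exists_forall_infDist_ext_lt`.
3. The boundary arc of the stadium `D_δ([a, b])` (`Literature.Probability.RandomPlanarGeometry.stadiumArc`, a graph over
   `[a - δ, b + δ]`; `upperHalfPlaneSet_inter_frontier_stadium`).
4. `E_δ` is a smooth `*`-hull (`isArcHull_arcHull`): `ℍ ∩ ∂E_δ = Φ_A⁻¹(ℍ ∩ ∂D_δ)`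
   (`mem_frontier_arcHull_iff`; points of `A ∩ ℍ` are interior by the cluster lemma), the arc
   being `E⁻¹ ∘ (∂D_δ)` with real endpoints on the free rays.
5. `⋂ₙ E_{δ_n} = A ∪ [p, q]` (`iInter_arcHull`) and the convergence
   `Φ_{E_{δ_n}} → Φ_A` (`tendstoUniformlyOn_arcHull`: `Φ_{E_δ} = Φ_{D_δ} ∘ Φ_A` by uniqueness
   of restriction maps, `E(closure S)` is a compact missing `[ℓ₋, ℓ₊]`, and `Φ_{D_δ} → id`
   uniformly there by `FlatHulls`).
6. The minus case by the reflection `σ(z) = -z̄` (`HullApproximation`).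
-/

noncomputable section

open Set Filter Topology Metric Bornology Complex
open UpperHalfPlane (upperHalfPlaneSet isOpen_upperHalfPlaneSet)
open scoped ComplexConjugate

namespace Literature.Probability.RandomPlanarGeometry

namespace IsSlitHull

variable {A : Set ℂ} {p q : ℝ} (h : IsSlitHull A p q)
include h

/-! ### `E` is bounded on bounded sets and bounded below away from `0` -/

/-- `|f| ≥ c > 0` outside a ball: the Riemann map `f : G → 𝔻` with `f(0) = 0` stays away from `0`
away from `0` (`f(G ∩ B(0, r))` is an open neighbourhood of `0`). [folklore] -/
theorem exists_forall_le_norm_riemannMap {r : ℝ} (hr : 0 < r) :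
    ∃ c > 0, ∀ w ∈ slitBall A p q, r ≤ ‖w‖ → c ≤ ‖h.riemannMap w‖ := by
  set V : Set ℂ := ball 0 r ∩ slitBall A p q with hV
  have hVo : IsOpen V := isOpen_ball.inter h.isOpen_slitBall
  have himg : IsOpen (h.riemannMap '' V) :=
    Complex.isOpen_image_of_deriv_ne_zero hVo (h.riemannMap.differentiableOn_coe.mono inter_subset_right)
      fun w hw ↦ h.deriv_riemannMap_ne_zero hw.2
  have h0 : (0 : ℂ) ∈ h.riemannMap '' V := ⟨0, ⟨mem_ball_self hr, zero_mem_slitBall⟩, h.riemannMap_zero⟩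
  obtain ⟨c, hc, hball⟩ := Metric.isOpen_iff.1 himg 0 h0
  refine ⟨c, hc, fun w hw hwr ↦ ?_⟩
  by_contra hlt
  push Not at hlt
  obtain ⟨v, hv, hveq⟩ := hball (mem_ball_zero_iff.2 hlt)
  have := h.riemannMap.injOn hv.2 hw hveq
  rw [this] at hv
  exact absurd hwr (not_le.2 (mem_ball_zero_iff.1 hv.1))

/-- **`E` is bounded on bounded subsets of `Ω`.** [folklore] -/
theorem exists_forall_norm_ext_le (R : ℝ) :
    ∃ M : ℝ, ∀ z ∈ slitDomain A p q, ‖z‖ ≤ R → ‖h.ext z‖ ≤ M := by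
  have hr : 0 < (|R| + |p| + 1)⁻¹ := by positivity
  obtain ⟨c, hc, hcf⟩ := h.exists_forall_le_norm_riemannMap hr
  refine ⟨h.derivConst * (1 + c⁻¹ + |h.joukowskiZero|), fun z hz hzR ↦ (h.norm_ext_le hz).trans ?_⟩
  refine mul_le_mul_of_nonneg_left ?_ h.derivConst_pos.le
  have hzp : z ≠ p := ne_p_of_mem_slitDomain hz
  have hι : (|R| + |p| + 1)⁻¹ ≤ ‖ofSlit p z‖ := by
    rw [ofSlit, norm_inv]
    refine inv_anti₀ (norm_pos_iff.2 (sub_ne_zero.2 hzp)) ?_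
    calc ‖z - p‖ ≤ ‖z‖ + ‖(p : ℂ)‖ := norm_sub_le _ _
      _ ≤ |R| + |p| + 1 := by rw [norm_real, Real.norm_eq_abs]; linarith [le_abs_self R]
  have hF : c ≤ ‖h.mapF z‖ := hcf _ (ofSlit_mem hz) hι
  have : ‖h.mapF z‖⁻¹ ≤ c⁻¹ := inv_anti₀ hc hF
  linarith

/-- **`E` is bounded below away from `0`** on `ℍ ∖ A` (its inverse tends to `0` only at `0`). [folklore] -/
theorem exists_forall_le_norm_ext {ρ : ℝ} (hρ : 0 < ρ) :
    ∃ c > 0, ∀ z ∈ upperHalfPlaneSet \ A, ρ ≤ ‖z‖ → c ≤ ‖h.ext z‖ := by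
  have hev : ∀ᶠ w in 𝓝[upperHalfPlaneSet] (0 : ℂ), ‖h.restrictionMap.symm w‖ < ρ := by
    have := h.tendsto_symm_nhdsWithin_zero.eventually (Metric.ball_mem_nhds (0 : ℂ) hρ)
    filter_upwards [this] with w hw
    simpa using hw
  obtain ⟨c, hc, hball⟩ := Metric.eventually_nhds_iff.1 (eventually_nhdsWithin_iff.1 hev)
  refine ⟨c, hc, fun z hz hzρ ↦ ?_⟩
  by_contra hlt
  push Not at hlt
  have h1 : dist (h.ext z) 0 < c := by rwa [dist_zero_right]
  have := hball h1 (h.mapsTo_ext hz)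
  rw [show h.restrictionMap.symm (h.ext z) = z from by
    have := h.restrictionMap.symm_apply_apply hz; rwa [restrictionMap_apply] at this] at this
  linarith

/-! ### `E` on the free real rays; the boundary values `ℓ₋`, `ℓ₊` -/

/-- The real trace of `E`: `x ↦ re E(x)`. [folklore] -/
def extRe (x : ℝ) : ℝ := (h.ext x).re

/-- On real points of `Ω`, `E = extRe`. [folklore] -/
theorem ext_ofReal_eq {x : ℝ} (hx : (x : ℂ) ∈ slitDomain A p q) : h.ext x = (h.extRe x : ℂ) :=
  Complex.ext (by simp [extRe]) (by rw [ofReal_im]; exact h.ext_ofReal_im hx)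

/-- The left free ray `(-∞, min p q)` lies in `Ω`. [folklore] -/
theorem ofReal_mem_slitDomain_of_lt {x : ℝ} (hx : x < min p q) : (x : ℂ) ∈ slitDomain A p q := by
  rw [h.ofReal_mem_slitDomain_iff, Set.mem_uIcc]
  rintro (⟨h1, -⟩ | ⟨h1, -⟩) <;> linarith [min_le_left p q, min_le_right p q]

/-- The right free ray `(max p q, ∞)` lies in `Ω`. [folklore] -/
theorem ofReal_mem_slitDomain_of_gt {x : ℝ} (hx : max p q < x) : (x : ℂ) ∈ slitDomain A p q := by
  rw [h.ofReal_mem_slitDomain_iff, Set.mem_uIcc]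
  rintro (⟨-, h1⟩ | ⟨-, h1⟩) <;> linarith [le_max_left p q, le_max_right p q]

/-- `extRe` is continuous at real points of `Ω`. [folklore] -/
theorem continuousAt_extRe {x : ℝ} (hx : (x : ℂ) ∈ slitDomain A p q) : ContinuousAt h.extRe x :=
  continuous_re.continuousAt.comp ((h.differentiableAt_ext hx).continuousAt.comp continuous_ofReal.continuousAt)

/-- `extRe` is differentiable at real points of `Ω`, with nonzero derivative. [folklore] -/
theorem hasDerivAt_extRe {x : ℝ} (hx : (x : ℂ) ∈ slitDomain A p q) :
    HasDerivAt h.extRe (deriv h.ext x).re x ∧ (deriv h.ext x).re ≠ 0 := by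
  have hd : HasDerivAt h.ext (deriv h.ext x) x := (h.differentiableAt_ext hx).hasDerivAt
  refine ⟨hd.real_of_complex, fun h0 ↦ h.deriv_ext_ne_zero hx (Complex.ext h0 ?_)⟩
  rw [zero_im]
  refine im_eq_zero_of_hasDerivAt_real hd ?_
  exact (continuous_ofReal.continuousAt.eventually (h.isOpen_slitDomain.mem_nhds hx)).mono
    fun t ht ↦ h.ext_ofReal_im ht

/-- `extRe` has no local maximum at a real point of `Ω` (its derivative does not vanish). [folklore] -/
theorem not_isLocalMax_extRe {x : ℝ} (hx : (x : ℂ) ∈ slitDomain A p q) : ¬ IsLocalMax h.extRe x := fun hmax ↦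
  (h.hasDerivAt_extRe hx).2 (hmax.hasDerivAt_eq_zero (h.hasDerivAt_extRe hx).1)

/-- `extRe` has no local minimum at a real point of `Ω`. [folklore] -/
theorem not_isLocalMin_extRe {x : ℝ} (hx : (x : ℂ) ∈ slitDomain A p q) : ¬ IsLocalMin h.extRe x := fun hmin ↦
  (h.hasDerivAt_extRe hx).2 (hmin.hasDerivAt_eq_zero (h.hasDerivAt_extRe hx).1)

/-- `E(x)/x → 1` along the reals. [folklore] -/
theorem tendsto_extRe_div_atBot : Tendsto (fun x : ℝ ↦ h.extRe x / x) atBot (𝓝 1) := by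
  have h1 : Tendsto (fun x : ℝ ↦ (x : ℂ)) atBot (cocompact ℂ) := by
    rw [← cobounded_eq_cocompact, ← tendsto_norm_atTop_iff_cobounded]
    simpa using tendsto_abs_atBot_atTop
  have h2 := ((continuous_re.tendsto 1).comp (h.tendsto_ext_div.comp h1))
  simp only [one_re] at h2
  refine h2.congr' ?_
  filter_upwards [eventually_lt_atBot (min p q)] with x hx
  simp only [Function.comp_apply, h.ext_ofReal_eq (h.ofReal_mem_slitDomain_of_lt hx), ← ofReal_div, ofReal_re]

/-- `E(x)/x → 1` along the reals, at `+∞`. [folklore] -/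
theorem tendsto_extRe_div_atTop : Tendsto (fun x : ℝ ↦ h.extRe x / x) atTop (𝓝 1) := by
  have h1 : Tendsto (fun x : ℝ ↦ (x : ℂ)) atTop (cocompact ℂ) := by
    rw [← cobounded_eq_cocompact, ← tendsto_norm_atTop_iff_cobounded]
    simpa using tendsto_abs_atTop_atTop
  have h2 := ((continuous_re.tendsto 1).comp (h.tendsto_ext_div.comp h1))
  simp only [one_re] at h2
  refine h2.congr' ?_
  filter_upwards [eventually_gt_atTop (max p q)] with x hx
  simp only [Function.comp_apply, h.ext_ofReal_eq (h.ofReal_mem_slitDomain_of_gt hx), ← ofReal_div, ofReal_re]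

/-- `extRe → -∞` at `-∞`. [folklore] -/
theorem tendsto_extRe_atBot : Tendsto h.extRe atBot atBot := by
  have hev : ∀ᶠ x : ℝ in atBot, h.extRe x ≤ x / 2 := by
    have h1 := (tendsto_order.1 h.tendsto_extRe_div_atBot).1 (1 / 2) (by norm_num)
    filter_upwards [h1, eventually_lt_atBot (0 : ℝ)] with x hx hx0
    rw [lt_div_iff_of_neg hx0] at hx
    linarith
  refine tendsto_atBot_mono' atBot hev ?_
  exact tendsto_id.atBot_div_const (by norm_num)

/-- `extRe → +∞` at `+∞`. [folklore] -/
theorem tendsto_extRe_atTop : Tendsto h.extRe atTop atTop := by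
  have hev : ∀ᶠ x : ℝ in atTop, x / 2 ≤ h.extRe x := by
    have h1 := (tendsto_order.1 h.tendsto_extRe_div_atTop).1 (1 / 2) (by norm_num)
    filter_upwards [h1, eventually_gt_atTop (0 : ℝ)] with x hx hx0
    rw [lt_div_iff₀ hx0] at hx
    linarith
  refine tendsto_atTop_mono' atTop hev ?_
  exact tendsto_id.atTop_div_const (by norm_num)

/-- The left image `extRe((-∞, min p q))`. [folklore] -/
def leftImage : Set ℝ := h.extRe '' Iio (min p q)

/-- The right image `extRe((max p q, ∞))`. [folklore] -/
def rightImage : Set ℝ := h.extRe '' Ioi (max p q)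

/-- The left image is bounded above. [folklore] -/
theorem bddAbove_leftImage : BddAbove h.leftImage := by
  obtain ⟨x₀, hx₀⟩ : ∃ x₀, ∀ x ≤ x₀, h.extRe x ≤ 0 := by
    have := (h.tendsto_extRe_atBot.eventually (eventually_le_atBot 0))
    rw [eventually_atBot] at this
    exact this
  obtain ⟨M, hM⟩ := h.exists_forall_norm_ext_le (max |x₀| |min p q|)
  refine ⟨max M 0, ?_⟩
  rintro _ ⟨x, hx, rfl⟩
  by_cases hxx₀ : x ≤ x₀
  · exact (hx₀ x hxx₀).trans (le_max_right _ _)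
  · push Not at hxx₀
    have hxn : ‖(x : ℂ)‖ ≤ max |x₀| |min p q| := by
      rw [norm_real, Real.norm_eq_abs, abs_le]
      constructor
      · linarith [le_max_left |x₀| |min p q|, neg_abs_le x₀]
      · have : x < min p q := hx
        linarith [le_max_right |x₀| |min p q|, le_abs_self (min p q)]
    have := hM _ (h.ofReal_mem_slitDomain_of_lt hx) hxn
    exact ((le_abs_self _).trans ((abs_re_le_norm _).trans this)).trans (le_max_left _ _)

/-- The right image is bounded below. [folklore] -/
theorem bddBelow_rightImage : BddBelow h.rightImage := by
  obtain ⟨x₀, hx₀⟩ : ∃ x₀, ∀ x ≥ x₀, 0 ≤ h.extRe x := by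
    have := (h.tendsto_extRe_atTop.eventually (eventually_ge_atTop 0))
    rw [eventually_atTop] at this
    exact this
  obtain ⟨M, hM⟩ := h.exists_forall_norm_ext_le (max |x₀| |max p q|)
  refine ⟨min (-M) 0, ?_⟩
  rintro _ ⟨x, hx, rfl⟩
  by_cases hxx₀ : x₀ ≤ x
  · exact (min_le_right _ _).trans (hx₀ x hxx₀)
  · push Not at hxx₀
    have hxn : ‖(x : ℂ)‖ ≤ max |x₀| |max p q| := by
      rw [norm_real, Real.norm_eq_abs, abs_le]
      constructor
      · have : max p q < x := hx
        linarith [le_max_right |x₀| |max p q|, neg_abs_le (max p q)]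
      · linarith [le_max_left |x₀| |max p q|, le_abs_self x₀]
    have := hM _ (h.ofReal_mem_slitDomain_of_gt hx) hxn
    have h1 : -M ≤ h.extRe x := by
      have h2 := (abs_re_le_norm (h.ext x)).trans this
      have h3 := neg_abs_le ((h.ext ↑x).re)
      show -M ≤ (h.ext x).re
      linarith
    exact (min_le_left _ _).trans h1

/-- The left image is nonempty. [folklore] -/
theorem leftImage_nonempty : h.leftImage.Nonempty :=
  ⟨_, min p q - 1, show min p q - 1 < min p q by linarith, rfl⟩

/-- The right image is nonempty. [folklore] -/
theorem rightImage_nonempty : h.rightImage.Nonempty :=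
  ⟨_, max p q + 1, show max p q < max p q + 1 by linarith, rfl⟩

/-- **The boundary value `ℓ₋ = Φ_A(p⁻)`** (for `p < q`; in general the supremum of `E` on the left
free ray). [folklore] -/
def lower : ℝ := sSup h.leftImage

/-- **The boundary value `ℓ₊ = Φ_A(q⁺)`** (the infimum of `E` on the right free ray). [folklore] -/
def upper : ℝ := sInf h.rightImage

/-- `E < ℓ₋` on the left free ray (the supremum is not attained: no local maximum). [folklore] -/
theorem extRe_lt_lower {x : ℝ} (hx : x < min p q) : h.extRe x < h.lower := by
  have hle : h.extRe x ≤ h.lower := le_csSup h.bddAbove_leftImage ⟨x, hx, rfl⟩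
  refine lt_of_le_of_ne hle fun heq ↦ h.not_isLocalMax_extRe (h.ofReal_mem_slitDomain_of_lt hx) ?_
  filter_upwards [Iio_mem_nhds hx] with y hy
  rw [heq]
  exact le_csSup h.bddAbove_leftImage ⟨y, hy, rfl⟩

/-- `ℓ₊ < E` on the right free ray. [folklore] -/
theorem upper_lt_extRe {x : ℝ} (hx : max p q < x) : h.upper < h.extRe x := by
  have hle : h.upper ≤ h.extRe x := csInf_le h.bddBelow_rightImage ⟨x, hx, rfl⟩
  refine lt_of_le_of_ne hle fun heq ↦ h.not_isLocalMin_extRe (h.ofReal_mem_slitDomain_of_gt hx) ?_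
  filter_upwards [Ioi_mem_nhds hx] with y hy
  rw [← heq]
  exact csInf_le h.bddBelow_rightImage ⟨y, hy, rfl⟩

/-- The left image is an interval unbounded below. [folklore] -/
theorem ordConnected_leftImage : h.leftImage.OrdConnected := by
  refine (IsPreconnected.image ?_ _ fun x hx ↦ (h.continuousAt_extRe
    (h.ofReal_mem_slitDomain_of_lt hx)).continuousWithinAt).ordConnected
  exact isPreconnected_Iio

/-- The right image is an interval unbounded above. [folklore] -/
theorem ordConnected_rightImage : h.rightImage.OrdConnected := by
  refine (IsPreconnected.image ?_ _ fun x hx ↦ (h.continuousAt_extRe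
    (h.ofReal_mem_slitDomain_of_gt hx)).continuousWithinAt).ordConnected
  exact isPreconnected_Ioi

/-- **`E` maps the left free ray ONTO `(-∞, ℓ₋)`.** [folklore] -/
theorem exists_extRe_eq_of_lt_lower {y : ℝ} (hy : y < h.lower) : ∃ x, x < min p q ∧ h.extRe x = y := by
  obtain ⟨_, ⟨x₁, hx₁, rfl⟩, hyx₁⟩ := exists_lt_of_lt_csSup h.leftImage_nonempty hy
  obtain ⟨x₂, hx₂⟩ : ∃ x₂, ∀ x ≤ x₂, h.extRe x ≤ y := by
    have := h.tendsto_extRe_atBot.eventually (eventually_le_atBot y)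
    rwa [eventually_atBot] at this
  set x₃ := min x₂ (min p q - 1) with hx₃
  have hx₃lt : x₃ < min p q := by have := min_le_right x₂ (min p q - 1); rw [hx₃]; linarith
  have hmem : y ∈ h.leftImage :=
    h.ordConnected_leftImage.out ⟨x₃, hx₃lt, rfl⟩ ⟨x₁, hx₁, rfl⟩ ⟨hx₂ x₃ (min_le_left _ _), hyx₁.le⟩
  obtain ⟨x, hx, hxy⟩ := hmem
  exact ⟨x, hx, hxy⟩

/-- **`E` maps the right free ray ONTO `(ℓ₊, ∞)`.** [folklore] -/
theorem exists_extRe_eq_of_upper_lt {y : ℝ} (hy : h.upper < y) : ∃ x, max p q < x ∧ h.extRe x = y := by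
  obtain ⟨_, ⟨x₁, hx₁, rfl⟩, hyx₁⟩ := exists_lt_of_csInf_lt h.rightImage_nonempty hy
  obtain ⟨x₂, hx₂⟩ : ∃ x₂, ∀ x ≥ x₂, y ≤ h.extRe x := by
    have := h.tendsto_extRe_atTop.eventually (eventually_ge_atTop y)
    rwa [eventually_atTop] at this
  set x₃ := max x₂ (max p q + 1) with hx₃
  have hx₃gt : max p q < x₃ := by have := le_max_right x₂ (max p q + 1); rw [hx₃]; linarith
  have hmem : y ∈ h.rightImage :=
    h.ordConnected_rightImage.out ⟨x₁, hx₁, rfl⟩ ⟨x₃, hx₃gt, rfl⟩ ⟨hyx₁.le, hx₂ x₃ (le_max_left _ _)⟩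
  obtain ⟨x, hx, hxy⟩ := hmem
  exact ⟨x, hx, hxy⟩

/-- **`ℓ₋ ≤ ℓ₊`**: the images of the two free rays are disjoint intervals, the left one unbounded
below. [folklore] -/
theorem lower_le_upper : h.lower ≤ h.upper := by
  by_contra hlt
  push Not at hlt
  -- a right value `r < ℓ₋`, which is then also a left value
  obtain ⟨_, ⟨xr, hxr, rfl⟩, hr⟩ := exists_lt_of_csInf_lt h.rightImage_nonempty hlt
  obtain ⟨xl, hxl, hEq⟩ := h.exists_extRe_eq_of_lt_lower hr
  have h1 : h.ext xl = h.ext xr := by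
    rw [h.ext_ofReal_eq (h.ofReal_mem_slitDomain_of_lt hxl), h.ext_ofReal_eq (h.ofReal_mem_slitDomain_of_gt hxr), hEq]
  have := h.injOn_ext (h.ofReal_mem_slitDomain_of_lt hxl) (h.ofReal_mem_slitDomain_of_gt hxr) h1
  have h2 : xl = xr := by exact_mod_cast this
  have : min p q ≤ max p q := min_le_max
  have h3 : max p q < xr := hxr
  linarith

/-- For slit data on the positive axis, `0 < ℓ₋` (`E(0) = 0` is a left value). [folklore] -/
theorem lower_pos (h0 : 0 < min p q) : 0 < h.lower := by
  have := h.extRe_lt_lower h0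
  rwa [extRe, ofReal_zero, h.ext_zero, zero_re] at this

/-- Real points of `Ω` are mapped OFF the segment `[ℓ₋, ℓ₊]`. [folklore] -/
theorem extRe_notMem_Icc {x : ℝ} (hx : (x : ℂ) ∈ slitDomain A p q) : h.extRe x ∉ Icc h.lower h.upper := by
  rw [h.ofReal_mem_slitDomain_iff, Set.mem_uIcc] at hx
  push Not at hx
  intro hmem
  rcases lt_or_ge x (min p q) with hlt | hge
  · linarith [h.extRe_lt_lower hlt, hmem.1]
  · have hgt : max p q < x := by
      rcases le_total p q with hpq | hpq
      · rw [min_eq_left hpq] at hge; rw [max_eq_right hpq]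
        by_contra hle; push Not at hle; exact absurd (hx.1 hge) (not_lt.2 hle)
      · rw [min_eq_right hpq] at hge; rw [max_eq_left hpq]
        by_contra hle; push Not at hle; exact absurd (hx.2 hge) (not_lt.2 hle)
    linarith [h.upper_lt_extRe hgt, hmem.2]

/-! ### The cluster lemma: boundary values of `Φ_A` along `A ∪ [p, q]` lie in `[ℓ₋, ℓ₊]` -/

/-- **`|F| → 1` at the non-free boundary.** If `z n ∈ Ω` tends to a point `a ∉ Ω`, then
`‖F(z n)‖ → 1`: `ι(z n)` leaves every compact of `G` (to `ι(a) ∉ G`, or to `∞` when `a = p`), and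
`f⁻¹(B̄(0, r))` is compact. [folklore] -/
theorem tendsto_norm_mapF {z : ℕ → ℂ} (hz : ∀ n, z n ∈ slitDomain A p q) {a : ℂ}
    (ha : a ∉ slitDomain A p q) (hlim : Tendsto z atTop (𝓝 a)) :
    Tendsto (fun n ↦ ‖h.mapF (z n)‖) atTop (𝓝 1) := by
  rw [tendsto_order]
  refine ⟨fun r hr ↦ ?_, fun r hr ↦ Eventually.of_forall fun n ↦ (h.norm_mapF_lt_one (hz n)).trans hr⟩
  by_contra hnot
  have hfreq : ∃ᶠ n in atTop, ‖h.mapF (z n)‖ ≤ r :=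
    (Filter.not_eventually.1 hnot).mono fun n hn ↦ not_lt.1 hn
  obtain ⟨φ, hφ, hφr⟩ := extraction_of_frequently_atTop hfreq
  -- the compact `f⁻¹(B̄(0, r)) ⊆ G`
  have hr1 : r < 1 := hr
  set Kc : Set ℂ := h.riemannMap.symm '' closedBall (0 : ℂ) r with hKc
  have hsub : closedBall (0 : ℂ) r ⊆ ball 0 1 := closedBall_subset_ball hr1
  have hKcpt : IsCompact Kc :=
    (isCompact_closedBall (0 : ℂ) r).image_of_continuousOn (h.riemannMap.symm.continuousOn.mono hsub)
  have hKcG : Kc ⊆ slitBall A p q := by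
    rintro _ ⟨v, hv, rfl⟩; exact h.riemannMap.symm_mapsTo (hsub hv)
  set w : ℕ → ℂ := fun k ↦ ofSlit p (z (φ k)) with hw
  have hwmem : ∀ k, w k ∈ Kc := fun k ↦ by
    refine ⟨h.riemannMap (w k), mem_closedBall_zero_iff.2 (hφr k), ?_⟩
    exact h.riemannMap.symm_apply_apply (ofSlit_mem (hz _))
  obtain ⟨wstar, hwstar, ψ, hψ, hwlim⟩ := hKcpt.tendsto_subseq hwmem
  by_cases hap : a = p
  · -- `ι (z n) → ∞`
    have hnorm : Tendsto (fun k ↦ ‖w (ψ k)‖) atTop atTop := by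
      have h1 : Tendsto (fun k ↦ z (φ (ψ k))) atTop (𝓝 a) := hlim.comp (hφ.tendsto_atTop.comp hψ.tendsto_atTop)
      have h2 : Tendsto (fun k ↦ ‖z (φ (ψ k)) - p‖) atTop (𝓝 0) := by
        have := (continuous_norm.tendsto _).comp (h1.sub_const (p : ℂ))
        rw [hap, sub_self, norm_zero] at this
        exact this
      have h3 : ∀ k, 0 < ‖z (φ (ψ k)) - p‖ := fun k ↦
        norm_pos_iff.2 (sub_ne_zero.2 (ne_p_of_mem_slitDomain (hz _)))
      have h4 : Tendsto (fun k ↦ ‖z (φ (ψ k)) - p‖⁻¹) atTop atTop :=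
        Filter.Tendsto.inv_tendsto_nhdsGT_zero (tendsto_nhdsWithin_iff.2 ⟨h2, Eventually.of_forall fun k ↦ h3 k⟩)
      simp only [hw, ofSlit, norm_inv]
      exact h4
    have hbdd := (continuous_norm.tendsto _).comp hwlim
    exact not_tendsto_atTop_of_tendsto_nhds hbdd hnorm
  · -- `ι (z n) → ι a ∉ G`
    have hιa : Tendsto (fun k ↦ w (ψ k)) atTop (𝓝 (ofSlit p a)) := by
      have hc : ContinuousAt (ofSlit p) a := (continuousOn_ofSlit a hap).continuousAt
        (isOpen_compl_singleton.mem_nhds hap)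
      exact hc.tendsto.comp (hlim.comp (hφ.tendsto_atTop.comp hψ.tendsto_atTop))
    have heq : wstar = ofSlit p a := tendsto_nhds_unique hwlim hιa
    have hG : ofSlit p a ∈ slitBall A p q := heq ▸ hKcG hwstar
    rcases hG with h0 | ⟨-, hΩ⟩
    · exact ofSlit_ne_zero hap h0
    · rw [toSlit_ofSlit hap] at hΩ
      exact ha hΩ

/-- **`im E → 0` at the non-free boundary** (`|F| → 1` and `im J(w) = im w (1 - |w|⁻²)`). [folklore] -/
theorem tendsto_im_ext {z : ℕ → ℂ} (hz : ∀ n, z n ∈ slitDomain A p q) {a : ℂ}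
    (ha : a ∉ slitDomain A p q) (hlim : Tendsto z atTop (𝓝 a)) :
    Tendsto (fun n ↦ (h.ext (z n)).im) atTop (𝓝 0) := by
  have h1 := h.tendsto_norm_mapF hz ha hlim
  have h2 : Tendsto (fun n ↦ 1 - (normSq (h.mapF (z n)))⁻¹) atTop (𝓝 0) := by
    have : Tendsto (fun n ↦ normSq (h.mapF (z n))) atTop (𝓝 1) := by
      have := h1.pow 2
      simpa [normSq_eq_norm_sq] using this
    have h3 := this.inv₀ one_ne_zero
    rw [inv_one] at h3
    have := (tendsto_const_nhds (x := (1 : ℝ))).sub h3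
    rwa [sub_self] at this
  have hbound : ∀ n, |(h.ext (z n)).im| ≤ h.derivConst * |1 - (normSq (h.mapF (z n)))⁻¹| := fun n ↦ by
    rw [h.ext_im, joukowski_im, abs_mul, abs_of_pos h.derivConst_pos, abs_mul]
    refine mul_le_mul_of_nonneg_left ?_ h.derivConst_pos.le
    have : |(h.mapF (z n)).im| ≤ 1 :=
      (abs_im_le_norm _).trans (h.norm_mapF_lt_one (hz n)).le
    nlinarith [abs_nonneg (1 - (normSq (h.mapF (z n)))⁻¹), abs_nonneg ((h.mapF (z n)).im)]
  refine squeeze_zero_norm (a := fun n ↦ h.derivConst * |1 - (normSq (h.mapF (z n)))⁻¹|) (fun n ↦ ?_) ?_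
  · rw [Real.norm_eq_abs]; exact hbound n
  · have := h2.abs.const_mul h.derivConst
    simpa using this

/-- The inverse of `E` on `E(Ω)` is continuous. [folklore] -/
theorem continuousOn_invFunOn_ext : ContinuousOn (Function.invFunOn h.ext (slitDomain A p q))
    (h.ext '' slitDomain A p q) :=
  (Complex.differentiableOn_invFunOn_image h.isOpen_slitDomain h.differentiableOn_ext h.injOn_ext
    fun _ hz ↦ h.deriv_ext_ne_zero hz).continuousOn

/-- **CLUSTER LEMMA.** If `z n ∈ ℍ ∖ A` tends to a point `a ∉ Ω` (a point of `A` or of the slit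
`[p, q]`) and `E(z n) → P`, then `P` is a real point of the segment `[ℓ₋, ℓ₊]`: it is real
(`im E → 0`), and a real `P` outside `[ℓ₋, ℓ₊]` is a value `E(x)` at a free real point `x ∈ Ω`,
where the continuous inverse of `E` would force `z n → x ≠ a`. [folklore] -/
theorem mem_realSeg_of_tendsto {z : ℕ → ℂ} (hz : ∀ n, z n ∈ upperHalfPlaneSet \ A) {a : ℂ}
    (ha : a ∉ slitDomain A p q) (hlim : Tendsto z atTop (𝓝 a)) {P : ℂ}
    (hP : Tendsto (fun n ↦ h.ext (z n)) atTop (𝓝 P)) : P ∈ realSeg h.lower h.upper := by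
  have hzΩ : ∀ n, z n ∈ slitDomain A p q := fun n ↦ h.diff_subset_slitDomain (hz n)
  have hPim : P.im = 0 :=
    tendsto_nhds_unique ((continuous_im.tendsto P).comp hP) (h.tendsto_im_ext hzΩ ha hlim)
  rw [mem_realSeg_iff, uIcc_of_le h.lower_le_upper]
  refine ⟨hPim, ?_⟩
  -- a real `x ∈ Ω` with `E x = P` is impossible
  have key : ∀ x : ℝ, (x : ℂ) ∈ slitDomain A p q → h.ext x ≠ P := by
    intro x hx hxP
    have hPmem : P ∈ h.ext '' slitDomain A p q := ⟨x, hx, hxP⟩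
    have hcont : ContinuousAt (Function.invFunOn h.ext (slitDomain A p q)) P :=
      (h.continuousOn_invFunOn_ext P hPmem).continuousAt (h.isOpen_image_ext.mem_nhds hPmem)
    have h1 : Tendsto (fun n ↦ Function.invFunOn h.ext (slitDomain A p q) (h.ext (z n))) atTop
        (𝓝 (Function.invFunOn h.ext (slitDomain A p q) P)) := hcont.tendsto.comp hP
    have h2 : ∀ n, Function.invFunOn h.ext (slitDomain A p q) (h.ext (z n)) = z n := fun n ↦
      h.injOn_ext.leftInvOn_invFunOn (hzΩ n)
    simp_rw [h2] at h1
    have h3 : Function.invFunOn h.ext (slitDomain A p q) P = x := by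
      rw [← hxP]; exact h.injOn_ext.leftInvOn_invFunOn hx
    rw [h3] at h1
    have := tendsto_nhds_unique hlim h1
    exact ha (this ▸ hx)
  have hPre : (P.re : ℂ) = P := Complex.ext (by simp) (by simp [hPim])
  by_contra hnot
  rw [mem_Icc, not_and_or, not_le, not_le] at hnot
  rcases hnot with hlt | hlt
  · obtain ⟨x, hx, hEx⟩ := h.exists_extRe_eq_of_lt_lower hlt
    refine key x (h.ofReal_mem_slitDomain_of_lt hx) ?_
    rw [h.ext_ofReal_eq (h.ofReal_mem_slitDomain_of_lt hx), hEx, hPre]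
  · obtain ⟨x, hx, hEx⟩ := h.exists_extRe_eq_of_upper_lt hlt
    refine key x (h.ofReal_mem_slitDomain_of_gt hx) ?_
    rw [h.ext_ofReal_eq (h.ofReal_mem_slitDomain_of_gt hx), hEx, hPre]

/-- **Uniform cluster lemma**: near a non-free boundary point `a ∉ Ω`, `E` maps `ℍ ∖ A` close to
the segment `[ℓ₋, ℓ₊]`. [folklore] -/
theorem exists_forall_infDist_ext_lt {a : ℂ} (ha : a ∉ slitDomain A p q) {ε : ℝ} (hε : 0 < ε) :
    ∃ r > 0, ∀ z ∈ upperHalfPlaneSet \ A, dist z a < r → infDist (h.ext z) (realSeg h.lower h.upper) < ε := by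
  by_contra hno
  push Not at hno
  choose z hzU hzdist hzfar using fun n : ℕ ↦ hno (1 / ((n : ℝ) + 1)) (by positivity)
  have hlim : Tendsto z atTop (𝓝 a) := by
    rw [tendsto_iff_dist_tendsto_zero]
    refine squeeze_zero (fun n ↦ dist_nonneg) (fun n ↦ (hzdist n).le) tendsto_one_div_add_atTop_nhds_zero_nat
  obtain ⟨M, hM⟩ := h.exists_forall_norm_ext_le (‖a‖ + 1)
  have hbdd : ∀ n, h.ext (z n) ∈ closedBall (0 : ℂ) M := fun n ↦ mem_closedBall_zero_iff.2
    (hM _ (h.diff_subset_slitDomain (hzU n)) (by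
      have := hzdist n
      have h1 : (1 : ℝ) / (n + 1) ≤ 1 := by rw [div_le_one (by positivity)]; linarith [n.cast_nonneg (α := ℝ)]
      calc ‖z n‖ = ‖(z n - a) + a‖ := by rw [sub_add_cancel]
        _ ≤ ‖z n - a‖ + ‖a‖ := norm_add_le _ _
        _ ≤ ‖a‖ + 1 := by rw [← dist_eq_norm]; linarith))
  obtain ⟨P, -, φ, hφ, hPlim⟩ := tendsto_subseq_of_bounded isBounded_closedBall hbdd
  have hPmem := h.mem_realSeg_of_tendsto (fun n ↦ hzU (φ n)) ha (hlim.comp hφ.tendsto_atTop) hPlim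
  have h1 : Tendsto (fun n ↦ infDist (h.ext (z (φ n))) (realSeg h.lower h.upper)) atTop (𝓝 0) := by
    have := ((continuous_infDist_pt (realSeg h.lower h.upper)).tendsto P).comp hPlim
    rwa [infDist_zero_of_mem hPmem] at this
  have h2 := (tendsto_order.1 h1).2 ε hε
  obtain ⟨n, hn⟩ := h2.exists
  exact absurd hn (not_lt.2 (hzfar (φ n)))

end IsSlitHull

/-! ### The boundary arc of the stadium `D_δ([a, b])` -/

section StadiumArc

variable {a b δ : ℝ}

/-- Lower bounds for the distance from a real point to `[a, b]`. [folklore] -/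
theorem sub_le_infDist_ofReal (hab : a ≤ b) (x : ℝ) :
    a - x ≤ infDist (x : ℂ) (realSeg a b) ∧ x - b ≤ infDist (x : ℂ) (realSeg a b) := by
  have key : ∀ y ∈ realSeg a b, a - x ≤ dist (x : ℂ) y ∧ x - b ≤ dist (x : ℂ) y := by
    intro y hy
    obtain ⟨t, ht, rfl⟩ := hy
    rw [uIcc_of_le hab] at ht
    rw [dist_eq_norm, ← ofReal_sub, norm_real, Real.norm_eq_abs]
    exact ⟨by linarith [neg_abs_le (x - t), ht.1], by linarith [le_abs_self (x - t), ht.2]⟩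
  exact ⟨(le_infDist (realSeg_nonempty a b)).2 fun y hy ↦ (key y hy).1,
    (le_infDist (realSeg_nonempty a b)).2 fun y hy ↦ (key y hy).2⟩

/-- The distance from a real point to `[a, b]` is the distance to its projection. [folklore] -/
theorem infDist_ofReal_eq (hab : a ≤ b) (x : ℝ) :
    infDist (x : ℂ) (realSeg a b) = |x - max a (min b x)| := by
  have hproj : ((max a (min b x) : ℝ) : ℂ) ∈ realSeg a b := by
    refine ofReal_mem_realSeg.2 ?_
    rw [uIcc_of_le hab]
    exact ⟨le_max_left _ _, max_le hab (min_le_left _ _)⟩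
  refine le_antisymm ((infDist_le_dist_of_mem hproj).trans (by
    rw [dist_eq_norm, ← ofReal_sub, norm_real, Real.norm_eq_abs])) ?_
  obtain ⟨h1, h2⟩ := sub_le_infDist_ofReal hab x
  rcases le_total x a with hxa | hxa
  · rw [min_eq_right (hxa.trans hab), max_eq_left hxa, abs_of_nonpos (by linarith)]; linarith
  · rcases le_total x b with hxb | hxb
    · rw [min_eq_right hxb, max_eq_right hxa, sub_self, abs_zero]; exact infDist_nonneg
    · rw [min_eq_left hxb, max_eq_right hab, abs_of_nonneg (by linarith)]; linarith

/-- **Pythagoras for the distance to a real segment**: `infDist z [a,b]² = infDist (re z) [a,b]² + (im z)²`. [folklore] -/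
theorem infDist_realSeg_sq (z : ℂ) :
    infDist z (realSeg a b) ^ 2 = infDist (z.re : ℂ) (realSeg a b) ^ 2 + z.im ^ 2 := by
  set d := infDist (z.re : ℂ) (realSeg a b) with hd
  have hd0 : 0 ≤ d := infDist_nonneg
  -- nearest point of the segment to `re z`
  obtain ⟨y, hy, hdy⟩ := (isCompact_realSeg (p := a) (q := b)).exists_infDist_eq_dist (realSeg_nonempty a b) (z.re : ℂ)
  have hyim := im_eq_zero_of_mem_realSeg hy
  have hdist : ∀ s ∈ realSeg a b, dist z s ^ 2 = dist (z.re : ℂ) s ^ 2 + z.im ^ 2 := fun s hs ↦ by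
    have hsim := im_eq_zero_of_mem_realSeg hs
    rw [dist_eq_norm, dist_eq_norm, ← normSq_eq_norm_sq, ← normSq_eq_norm_sq, normSq_apply, normSq_apply]
    simp [hsim]
    ring
  have hupper : infDist z (realSeg a b) ≤ Real.sqrt (d ^ 2 + z.im ^ 2) := by
    refine (infDist_le_dist_of_mem hy).trans (le_of_eq ?_)
    rw [← Real.sqrt_sq dist_nonneg, hdist y hy, ← hdy]
  have hlower : Real.sqrt (d ^ 2 + z.im ^ 2) ≤ infDist z (realSeg a b) := by
    refine (le_infDist (realSeg_nonempty a b)).2 fun s hs ↦ ?_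
    rw [← Real.sqrt_sq (dist_nonneg (x := z) (y := s)), hdist s hs]
    refine Real.sqrt_le_sqrt (by nlinarith [infDist_le_dist_of_mem (x := (z.re : ℂ)) hs, hd0])
  have heq := le_antisymm hupper hlower
  rw [heq, Real.sq_sqrt (by positivity)]

/-- Moving up strictly increases the distance to a real segment (from `Im ≥ 0`). [folklore] -/
theorem infDist_lt_infDist_add_mul_I {z : ℂ} (hz : 0 ≤ z.im) {t : ℝ} (ht : 0 < t) :
    infDist z (realSeg a b) < infDist (z + t * I) (realSeg a b) := by
  have h1 := infDist_realSeg_sq (a := a) (b := b) z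
  have h2 := infDist_realSeg_sq (a := a) (b := b) (z + t * I)
  have hre : (z + t * I).re = z.re := by simp
  have him : (z + t * I).im = z.im + t := by simp
  rw [hre, him] at h2
  have hlt : infDist z (realSeg a b) ^ 2 < infDist (z + t * I) (realSeg a b) ^ 2 := by
    rw [h1, h2]; nlinarith
  exact lt_of_pow_lt_pow_left₀ 2 infDist_nonneg hlt

/-- The horizontal parameter `x(t) = (a - δ) + t (b - a + 2δ)` of the boundary arc. [folklore] -/
def stadiumX (a b δ t : ℝ) : ℝ := (a - δ) + t * (b - a + 2 * δ)

/-- **The boundary arc of the stadium**: the graph `x ↦ x + i √(δ² - infDist(x, [a,b])²)` over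
`[a - δ, b + δ]`, parametrized by `[0, 1]`. [folklore] -/
def stadiumArc (a b δ t : ℝ) : ℂ :=
  (stadiumX a b δ t : ℂ) + (Real.sqrt (δ ^ 2 - infDist (stadiumX a b δ t : ℂ) (realSeg a b) ^ 2) : ℂ) * I

/-- Real part of the arc. [folklore] -/
theorem stadiumArc_re (t : ℝ) : (stadiumArc a b δ t).re = stadiumX a b δ t := by
  simp [stadiumArc]

/-- Imaginary part of the arc. [folklore] -/
theorem stadiumArc_im (t : ℝ) :
    (stadiumArc a b δ t).im = Real.sqrt (δ ^ 2 - infDist (stadiumX a b δ t : ℂ) (realSeg a b) ^ 2) := by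
  simp [stadiumArc]

/-- The arc is continuous. [folklore] -/
theorem continuous_stadiumArc : Continuous (stadiumArc a b δ) := by
  have hx : Continuous (stadiumX a b δ) := by unfold stadiumX; fun_prop
  unfold stadiumArc
  refine (continuous_ofReal.comp hx).add (Continuous.mul (continuous_ofReal.comp ?_) continuous_const)
  exact (continuous_const.sub (((continuous_infDist_pt _).comp (continuous_ofReal.comp hx)).pow 2)).sqrt

/-- The horizontal parameter ranges over `[a - δ, b + δ]`. [folklore] -/
theorem stadiumX_mem_Icc (_hab : a ≤ b) (hδ : 0 ≤ δ) {t : ℝ} (ht : t ∈ Icc (0 : ℝ) 1) :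
    stadiumX a b δ t ∈ Icc (a - δ) (b + δ) := by
  unfold stadiumX
  constructor <;> nlinarith [ht.1, ht.2]

/-- The horizontal parameter of interior times lies in `(a - δ, b + δ)`. [folklore] -/
theorem stadiumX_mem_Ioo (hab : a ≤ b) (hδ : 0 < δ) {t : ℝ} (ht : t ∈ Ioo (0 : ℝ) 1) :
    stadiumX a b δ t ∈ Ioo (a - δ) (b + δ) := by
  unfold stadiumX
  constructor <;> nlinarith [ht.1, ht.2]

/-- The arc is injective (its real part is strictly increasing). [folklore] -/
theorem injOn_stadiumArc (hab : a ≤ b) (hδ : 0 < δ) : InjOn (stadiumArc a b δ) (Icc 0 1) := by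
  intro t _ t' _ heq
  have := congrArg Complex.re heq
  rw [stadiumArc_re, stadiumArc_re] at this
  unfold stadiumX at this
  have hpos : 0 < b - a + 2 * δ := by linarith
  nlinarith [this]

/-- On `[a - δ, b + δ]` the distance of a real point to `[a, b]` is at most `δ`; strictly less in
the interior, and `= δ` at the two corners. [folklore] -/
theorem infDist_ofReal_le_of_mem_Icc (hab : a ≤ b) (hδ : 0 ≤ δ) {x : ℝ} (hx : x ∈ Icc (a - δ) (b + δ)) :
    infDist (x : ℂ) (realSeg a b) ≤ δ := by
  rw [infDist_ofReal_eq hab, abs_le]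
  rcases le_total x a with hxa | hxa
  · rw [min_eq_right (hxa.trans hab), max_eq_left hxa]; constructor <;> linarith [hx.1]
  · rcases le_total x b with hxb | hxb
    · rw [min_eq_right hxb, max_eq_right hxa]; constructor <;> linarith [hx.1, hx.2]
    · rw [min_eq_left hxb, max_eq_right hab]; constructor <;> linarith [hx.2]

/-- Strictly inside `(a - δ, b + δ)` the distance to `[a, b]` is `< δ`. [folklore] -/
theorem infDist_ofReal_lt_of_mem_Ioo (hab : a ≤ b) (hδ : 0 < δ) {x : ℝ} (hx : x ∈ Ioo (a - δ) (b + δ)) :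
    infDist (x : ℂ) (realSeg a b) < δ := by
  rw [infDist_ofReal_eq hab, abs_lt]
  rcases le_total x a with hxa | hxa
  · rw [min_eq_right (hxa.trans hab), max_eq_left hxa]; constructor <;> linarith [hx.1, hx.2]
  · rcases le_total x b with hxb | hxb
    · rw [min_eq_right hxb, max_eq_right hxa]; constructor <;> linarith [hx.1, hx.2]
    · rw [min_eq_left hxb, max_eq_right hab]; constructor <;> linarith [hx.1, hx.2]

/-- The boundary arc is at distance exactly `δ` from the segment. [folklore] -/
theorem infDist_stadiumArc (hab : a ≤ b) (hδ : 0 ≤ δ) {t : ℝ} (ht : t ∈ Icc (0 : ℝ) 1) :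
    infDist (stadiumArc a b δ t) (realSeg a b) = δ := by
  have hd := infDist_ofReal_le_of_mem_Icc hab hδ (stadiumX_mem_Icc hab hδ ht)
  have hsq := infDist_realSeg_sq (a := a) (b := b) (stadiumArc a b δ t)
  rw [stadiumArc_re, stadiumArc_im, Real.sq_sqrt (by nlinarith [infDist_nonneg (x := ((stadiumX a b δ t : ℝ) : ℂ)) (s := realSeg a b)])] at hsq
  have : infDist (stadiumArc a b δ t) (realSeg a b) ^ 2 = δ ^ 2 := by rw [hsq]; ring
  exact (pow_left_inj₀ infDist_nonneg hδ two_ne_zero).1 this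

/-- Interior points of the arc lie in `ℍ`. [folklore] -/
theorem stadiumArc_im_pos (hab : a ≤ b) (hδ : 0 < δ) {t : ℝ} (ht : t ∈ Ioo (0 : ℝ) 1) :
    0 < (stadiumArc a b δ t).im := by
  rw [stadiumArc_im]
  have hd := infDist_ofReal_lt_of_mem_Ioo hab hδ (stadiumX_mem_Ioo hab hδ ht)
  have hd0 : 0 ≤ infDist ((stadiumX a b δ t : ℝ) : ℂ) (realSeg a b) := infDist_nonneg
  exact Real.sqrt_pos.2 (by nlinarith)

/-- At the corners the distance of `a - δ`, `b + δ` to `[a, b]` is `δ`. [folklore] -/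
theorem infDist_corner_left (hab : a ≤ b) (hδ : 0 ≤ δ) : infDist ((a - δ : ℝ) : ℂ) (realSeg a b) = δ := by
  rw [infDist_ofReal_eq hab, min_eq_right (by linarith : a - δ ≤ b), max_eq_left (by linarith : a - δ ≤ a)]
  rw [show a - δ - a = -δ by ring, abs_neg, abs_of_nonneg hδ]

/-- The right corner is at distance `δ`. [folklore] -/
theorem infDist_corner_right (hab : a ≤ b) (hδ : 0 ≤ δ) : infDist ((b + δ : ℝ) : ℂ) (realSeg a b) = δ := by
  rw [infDist_ofReal_eq hab, min_eq_left (by linarith : b ≤ b + δ), max_eq_right hab]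
  rw [show b + δ - b = δ by ring, abs_of_nonneg hδ]

/-- The endpoints of the arc are real. [folklore] -/
theorem stadiumArc_zero_im (hab : a ≤ b) (hδ : 0 ≤ δ) : (stadiumArc a b δ 0).im = 0 := by
  rw [stadiumArc_im, show stadiumX a b δ 0 = a - δ by unfold stadiumX; ring, infDist_corner_left hab hδ,
    sub_self, Real.sqrt_zero]

/-- The right endpoint of the arc is real. [folklore] -/
theorem stadiumArc_one_im (hab : a ≤ b) (hδ : 0 ≤ δ) : (stadiumArc a b δ 1).im = 0 := by
  rw [stadiumArc_im, show stadiumX a b δ 1 = b + δ by unfold stadiumX; ring, infDist_corner_right hab hδ,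
    sub_self, Real.sqrt_zero]

/-- **The frontier of the stadium in `ℍ` is the open boundary arc.** [folklore] -/
theorem upperHalfPlaneSet_inter_frontier_stadium (hab : a ≤ b) (hδ : 0 < δ) :
    upperHalfPlaneSet ∩ frontier (stadium a b δ) = stadiumArc a b δ '' Ioo 0 1 := by
  apply Subset.antisymm
  · rintro w ⟨hwH, hwfr⟩
    have hwD : w ∈ stadium a b δ := isClosed_stadium.frontier_subset hwfr
    have hwim : 0 < w.im := hwH
    -- `infDist w = δ`
    have hdist : infDist w (realSeg a b) = δ := by
      refine le_antisymm hwD.2 (not_lt.1 fun hlt ↦ ?_)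
      have hU : IsOpen {z : ℂ | 0 < z.im ∧ infDist z (realSeg a b) < δ} :=
        (isOpen_lt continuous_const continuous_im).inter (isOpen_lt (continuous_infDist_pt _) continuous_const)
      have hsub : {z : ℂ | 0 < z.im ∧ infDist z (realSeg a b) < δ} ⊆ stadium a b δ :=
        fun z hz ↦ ⟨hz.1.le, hz.2.le⟩
      have hwint : w ∈ interior (stadium a b δ) := interior_maximal hsub hU ⟨hwim, hlt⟩
      rw [frontier, Set.mem_sdiff] at hwfr
      exact hwfr.2 hwint
    -- locate `re w`
    have hsq := infDist_realSeg_sq (a := a) (b := b) w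
    rw [hdist] at hsq
    set x := w.re with hx
    have hd0 : 0 ≤ infDist (x : ℂ) (realSeg a b) := infDist_nonneg
    have hdlt : infDist (x : ℂ) (realSeg a b) < δ := by nlinarith
    obtain ⟨h1, h2⟩ := sub_le_infDist_ofReal hab x
    have hxI : x ∈ Ioo (a - δ) (b + δ) := ⟨by linarith, by linarith⟩
    have hL : 0 < b - a + 2 * δ := by linarith
    set t : ℝ := (x - (a - δ)) / (b - a + 2 * δ) with ht
    have htI : t ∈ Ioo (0 : ℝ) 1 := by
      rw [ht, mem_Ioo, lt_div_iff₀ hL, div_lt_iff₀ hL]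
      constructor <;> nlinarith [hxI.1, hxI.2]
    have hxt : stadiumX a b δ t = x := by
      unfold stadiumX
      rw [ht, div_mul_cancel₀ _ hL.ne']
      ring
    refine ⟨t, htI, ?_⟩
    apply Complex.ext
    · rw [stadiumArc_re, hxt]
    · rw [stadiumArc_im, hxt]
      have : δ ^ 2 - infDist (x : ℂ) (realSeg a b) ^ 2 = w.im ^ 2 := by linarith
      rw [this, Real.sqrt_sq hwim.le]
  · rintro _ ⟨t, ht, rfl⟩
    have him := stadiumArc_im_pos hab hδ ht
    refine ⟨him, ?_⟩
    rw [frontier_eq_closure_inter_closure]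
    refine ⟨subset_closure ⟨him.le, (infDist_stadiumArc hab hδ.le ⟨ht.1.le, ht.2.le⟩).le⟩, ?_⟩
    -- approach from above, outside the stadium
    have hpath : Tendsto (fun s : ℝ ↦ stadiumArc a b δ t + s * I) (𝓝[>] 0) (𝓝 (stadiumArc a b δ t)) := by
      have : Continuous fun s : ℝ ↦ stadiumArc a b δ t + s * I := by fun_prop
      simpa using (this.tendsto 0).mono_left nhdsWithin_le_nhds
    refine mem_closure_of_tendsto hpath ?_
    filter_upwards [self_mem_nhdsWithin] with s hs
    intro hmem
    have := infDist_lt_infDist_add_mul_I (a := a) (b := b) him.le hs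
    rw [infDist_stadiumArc hab hδ.le ⟨ht.1.le, ht.2.le⟩] at this
    linarith [hmem.2]

end StadiumArc

/-! ### The hulls `E_δ = D_δ · A` and their smooth-hull structure -/

namespace IsSlitHull

variable {A : Set ℂ} {p q : ℝ} (h : IsSlitHull A p q)
include h

/-- **The approximating hull `E_δ = D_δ([ℓ₋, ℓ₊]) · A`** of [LSW]'s proof of Lemma 3.5 ("`E_δ`, the
closure of `A ∪ Φ_A⁻¹(D_δ)`"), as the product hull of `RestrictionSemigroup`.
[cite: LawlerSchrammWerner2003Restriction, proof of Lemma 3.5 (p. 13, the hulls E_δ)] -/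
def arcHull (δ : ℝ) : Set ℂ := _root_.Literature.Probability.RandomPlanarGeometry.hullProduct (stadium h.lower h.upper δ) A h.restrictionMap

/-- Admissible thickness: `0 < δ`, `2δ < ℓ₋`. The stadium is then a one-sided hull. [folklore] -/
theorem isSlitHull_stadium_lower_upper {δ : ℝ} (hδ : 0 < δ) (hδl : 2 * δ < h.lower) :
    IsSlitHull (stadium h.lower h.upper δ) (h.lower - 2 * δ) (h.upper + δ) :=
  isSlitHull_stadium h.lower_le_upper hδ hδl

/-- `E_δ ∩ ℍ = (A ∩ ℍ) ∪ Φ_A⁻¹(D_δ)`. [folklore] -/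
theorem arcHull_inter {δ : ℝ} :
    h.arcHull δ ∩ upperHalfPlaneSet = A ∩ upperHalfPlaneSet ∪ {z | z ∈ upperHalfPlaneSet \ A ∧ h.ext z ∈ stadium h.lower h.upper δ} := by
  rw [arcHull, hullProduct_inter isClosed_stadium h.isClosed_A]
  rfl

/-- `E_δ = cl(E_δ ∩ ℍ)`. [folklore] -/
theorem closure_arcHull_inter {δ : ℝ} : closure (h.arcHull δ ∩ upperHalfPlaneSet) = h.arcHull δ := by
  rw [arcHull, hullProduct_inter isClosed_stadium h.isClosed_A]; rfl

/-- Points of `Φ_A⁻¹(D_δ)` lie in `E_δ`. [folklore] -/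
theorem mem_arcHull_of_mem_core {δ : ℝ} {z : ℂ} (hz : z ∈ upperHalfPlaneSet \ A)
    (hEz : h.ext z ∈ stadium h.lower h.upper δ) : z ∈ h.arcHull δ := by
  have : z ∈ h.arcHull δ ∩ upperHalfPlaneSet := by rw [h.arcHull_inter]; exact Or.inr ⟨hz, hEz⟩
  exact this.1

/-- Points of `E_δ ∩ (ℍ ∖ A)` are mapped into `D_δ`. [folklore] -/
theorem ext_mem_stadium_of_mem_arcHull {δ : ℝ} {z : ℂ} (hz : z ∈ upperHalfPlaneSet \ A) (hzJ : z ∈ h.arcHull δ) :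
    h.ext z ∈ stadium h.lower h.upper δ := by
  have : z ∈ h.arcHull δ ∩ upperHalfPlaneSet := ⟨hzJ, hz.1⟩
  rw [h.arcHull_inter] at this
  rcases this with hzA | hzc
  · exact absurd hzA.1 hz.2
  · exact hzc.2

/-- `E_δ` is a `*`-hull. [folklore] -/
theorem isStarHull_arcHull {δ : ℝ} (hδ : 0 < δ) (hδl : 2 * δ < h.lower) :
    IsStarHull (h.arcHull δ) :=
  (h.isSlitHull_stadium_lower_upper hδ hδl).isStarHull.hullProduct h.isStarHull h.isRestrictionMap

/-- `E_δ` is closed. [folklore] -/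
theorem isClosed_arcHull {δ : ℝ} : IsClosed (h.arcHull δ) := isClosed_closure

/-- `A ⊆ E_δ`. [folklore] -/
theorem subset_arcHull {δ : ℝ} : A ⊆ h.arcHull δ := by
  intro z hz
  have hcl := h.isStarHull.isBoundedHull.closure_inter_eq
  have hz' : z ∈ closure (A ∩ upperHalfPlaneSet) := by rw [hcl]; exact hz
  refine closure_minimal (fun w hw ↦ ?_) h.isClosed_arcHull hz'
  exact (show w ∈ h.arcHull δ ∩ upperHalfPlaneSet by rw [h.arcHull_inter]; exact Or.inl hw).1

/-- `E_δ` decreases with `δ`. [folklore] -/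
theorem arcHull_mono {δ δ' : ℝ} (hδδ' : δ ≤ δ') : h.arcHull δ ⊆ h.arcHull δ' := by
  refine closure_mono ?_
  rintro z (hz | ⟨hz, hEz⟩)
  · exact Or.inl hz
  · exact Or.inr ⟨hz, hEz.1, hEz.2.trans hδδ'⟩

/-! #### The boundary arc of `E_δ` -/

/-- The inverse of `E` on `E(Ω)`. [folklore] -/
def invExt : ℂ → ℂ := Function.invFunOn h.ext (slitDomain A p q)

/-- `E⁻¹ ∘ E = id` on `Ω`. [folklore] -/
theorem invExt_ext {z : ℂ} (hz : z ∈ slitDomain A p q) : h.invExt (h.ext z) = z :=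
  h.injOn_ext.leftInvOn_invFunOn hz

/-- `E ∘ E⁻¹ = id` on `E(Ω)`. [folklore] -/
theorem ext_invExt {w : ℂ} (hw : w ∈ h.ext '' slitDomain A p q) : h.ext (h.invExt w) = w :=
  Function.invFunOn_eq hw

/-- `E⁻¹` maps `E(Ω)` into `Ω`. [folklore] -/
theorem invExt_mem {w : ℂ} (hw : w ∈ h.ext '' slitDomain A p q) : h.invExt w ∈ slitDomain A p q :=
  Function.invFunOn_mem hw

/-- `E⁻¹` is injective on `E(Ω)`. [folklore] -/
theorem injOn_invExt : InjOn h.invExt (h.ext '' slitDomain A p q) := fun w hw w' hw' heq ↦ by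
  rw [← h.ext_invExt hw, ← h.ext_invExt hw', heq]

/-- `E⁻¹` is continuous on `E(Ω)`. [folklore] -/
theorem continuousOn_invExt : ContinuousOn h.invExt (h.ext '' slitDomain A p q) := h.continuousOn_invFunOn_ext

/-- On `ℍ`, the inverse is `Φ_A⁻¹`, valued in `ℍ ∖ A`. [folklore] -/
theorem invExt_eq_symm {w : ℂ} (hw : w ∈ upperHalfPlaneSet) : h.invExt w = h.restrictionMap.symm w :=
  (h.symm_eq_invFunOn hw).symm

/-- `ℍ ⊆ E(Ω)`. [folklore] -/
theorem upperHalfPlaneSet_subset_image_ext : upperHalfPlaneSet ⊆ h.ext '' slitDomain A p q := by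
  rw [← h.image_ext_diff]; exact image_mono h.diff_subset_slitDomain

/-- A real value below `ℓ₋` is attained on the left free ray, in `Ω`. [folklore] -/
theorem ofReal_mem_image_ext_of_lt_lower {y : ℝ} (hy : y < h.lower) : (y : ℂ) ∈ h.ext '' slitDomain A p q := by
  obtain ⟨x, hx, hxy⟩ := h.exists_extRe_eq_of_lt_lower hy
  exact ⟨x, h.ofReal_mem_slitDomain_of_lt hx, by rw [h.ext_ofReal_eq (h.ofReal_mem_slitDomain_of_lt hx), hxy]⟩

/-- A real value above `ℓ₊` is attained on the right free ray. [folklore] -/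
theorem ofReal_mem_image_ext_of_upper_lt {y : ℝ} (hy : h.upper < y) : (y : ℂ) ∈ h.ext '' slitDomain A p q := by
  obtain ⟨x, hx, hxy⟩ := h.exists_extRe_eq_of_upper_lt hy
  exact ⟨x, h.ofReal_mem_slitDomain_of_gt hx, by rw [h.ext_ofReal_eq (h.ofReal_mem_slitDomain_of_gt hx), hxy]⟩

/-- The inverse of `E` is real at real points of `E(Ω)`. [folklore] -/
theorem invExt_ofReal_im {y : ℝ} (hy : (y : ℂ) ∈ h.ext '' slitDomain A p q) : (h.invExt y).im = 0 := by
  have hz := h.invExt_mem hy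
  rw [← conj_eq_iff_im]
  refine h.injOn_ext (conj_mem_slitDomain_iff.2 hz) hz ?_
  rw [h.ext_conj hz, h.ext_invExt hy, conj_ofReal]

/-- **The boundary arc of `E_δ`**: `γ = E⁻¹ ∘ (boundary arc of D_δ)`. [folklore] -/
def hullArc (δ : ℝ) (t : ℝ) : ℂ := h.invExt (stadiumArc h.lower h.upper δ t)

/-- The stadium arc lies in `E(Ω)`: interior points in `ℍ = E(ℍ ∖ A)`, the endpoints
`ℓ₋ - δ`, `ℓ₊ + δ` are values on the free real rays. [folklore] -/
theorem stadiumArc_mem_image_ext {δ : ℝ} (hδ : 0 < δ) {t : ℝ} (ht : t ∈ Icc (0 : ℝ) 1) :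
    stadiumArc h.lower h.upper δ t ∈ h.ext '' slitDomain A p q := by
  rcases ht.1.lt_or_eq with h0 | h0
  · rcases ht.2.lt_or_eq with h1 | h1
    · exact h.upperHalfPlaneSet_subset_image_ext (stadiumArc_im_pos h.lower_le_upper hδ ⟨h0, h1⟩)
    · subst h1
      have heq : stadiumArc h.lower h.upper δ 1 = ((h.upper + δ : ℝ) : ℂ) :=
        Complex.ext (by rw [stadiumArc_re]; unfold stadiumX; simp; ring)
          (by rw [stadiumArc_one_im h.lower_le_upper hδ.le, ofReal_im])
      rw [heq]; exact h.ofReal_mem_image_ext_of_upper_lt (by linarith)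
  · subst h0
    have heq : stadiumArc h.lower h.upper δ 0 = ((h.lower - δ : ℝ) : ℂ) :=
      Complex.ext (by rw [stadiumArc_re]; unfold stadiumX; simp)
        (by rw [stadiumArc_zero_im h.lower_le_upper hδ.le, ofReal_im])
    rw [heq]; exact h.ofReal_mem_image_ext_of_lt_lower (by linarith)

/-- The boundary arc of `E_δ` is continuous. [folklore] -/
theorem continuousOn_hullArc {δ : ℝ} (hδ : 0 < δ) : ContinuousOn (h.hullArc δ) (Icc 0 1) :=
  h.continuousOn_invExt.comp continuous_stadiumArc.continuousOn fun _ ht ↦ h.stadiumArc_mem_image_ext hδ ht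

/-- The boundary arc of `E_δ` is injective. [folklore] -/
theorem injOn_hullArc {δ : ℝ} (hδ : 0 < δ) : InjOn (h.hullArc δ) (Icc 0 1) := fun _ ht _ ht' heq ↦
  injOn_stadiumArc h.lower_le_upper hδ ht ht'
    (h.injOn_invExt (h.stadiumArc_mem_image_ext hδ ht) (h.stadiumArc_mem_image_ext hδ ht') heq)

/-- The left endpoint of the boundary arc of `E_δ` is real. [folklore] -/
theorem hullArc_zero_im {δ : ℝ} (hδ : 0 < δ) : (h.hullArc δ 0).im = 0 := by
  have heq : stadiumArc h.lower h.upper δ 0 = ((h.lower - δ : ℝ) : ℂ) :=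
    Complex.ext (by rw [stadiumArc_re]; unfold stadiumX; simp)
      (by rw [stadiumArc_zero_im h.lower_le_upper hδ.le, ofReal_im])
  rw [hullArc, heq]
  exact h.invExt_ofReal_im (h.ofReal_mem_image_ext_of_lt_lower (by linarith))

/-- The right endpoint of the boundary arc of `E_δ` is real. [folklore] -/
theorem hullArc_one_im {δ : ℝ} (hδ : 0 < δ) : (h.hullArc δ 1).im = 0 := by
  have heq : stadiumArc h.lower h.upper δ 1 = ((h.upper + δ : ℝ) : ℂ) :=
    Complex.ext (by rw [stadiumArc_re]; unfold stadiumX; simp; ring)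
      (by rw [stadiumArc_one_im h.lower_le_upper hδ.le, ofReal_im])
  rw [hullArc, heq]
  exact h.invExt_ofReal_im (h.ofReal_mem_image_ext_of_upper_lt (by linarith))

/-- Interior points of the boundary arc of `E_δ` lie in `ℍ ∖ A`. [folklore] -/
theorem hullArc_mem_of_mem_Ioo {δ : ℝ} (hδ : 0 < δ) {t : ℝ} (ht : t ∈ Ioo (0 : ℝ) 1) :
    h.hullArc δ t ∈ upperHalfPlaneSet \ A := by
  have hw := stadiumArc_im_pos h.lower_le_upper hδ ht
  rw [hullArc, h.invExt_eq_symm hw]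
  exact h.symm_mem hw

/-! #### The frontier of `E_δ` in `ℍ` -/

/-- Points of `A ∩ ℍ` are interior points of `E_δ` (uniform cluster lemma: nearby points of
`ℍ ∖ A` are mapped into `D_δ`). [folklore] -/
theorem mem_interior_arcHull_of_mem {δ : ℝ} (hδ : 0 < δ) {z : ℂ} (hz : z ∈ A ∩ upperHalfPlaneSet) :
    z ∈ interior (h.arcHull δ) := by
  have hzΩ : z ∉ slitDomain A p q := fun hzΩ ↦ ((h.mem_slitDomain_iff_of_im_pos hz.2).1 hzΩ) hz.1
  obtain ⟨r, hr, hrS⟩ := h.exists_forall_infDist_ext_lt hzΩ hδ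
  have hzim : 0 < z.im := hz.2
  rw [mem_interior_iff_mem_nhds]
  refine Filter.mem_of_superset (ball_mem_nhds z (lt_min hr hzim)) fun w hw ↦ ?_
  rw [mem_ball] at hw
  have hwH : w ∈ upperHalfPlaneSet := by
    show 0 < w.im
    have := abs_im_le_norm (w - z)
    rw [sub_im, ← dist_eq_norm] at this
    have h2 := lt_min_iff.1 hw
    linarith [neg_abs_le (w.im - z.im)]
  by_cases hwA : w ∈ A
  · exact h.subset_arcHull hwA
  · refine h.mem_arcHull_of_mem_core ⟨hwH, hwA⟩ ⟨(h.mapsTo_ext ⟨hwH, hwA⟩).le, ?_⟩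
    exact (hrS w ⟨hwH, hwA⟩ ((lt_min_iff.1 hw).1)).le

/-- **The frontier of `E_δ` in `ℍ`** corresponds under `Φ_A` to the frontier of `D_δ` in `ℍ`. [folklore] -/
theorem mem_frontier_arcHull_iff {δ : ℝ} (hδ : 0 < δ) {z : ℂ} (hz : z ∈ upperHalfPlaneSet) :
    z ∈ frontier (h.arcHull δ) ↔ z ∉ A ∧ h.ext z ∈ frontier (stadium h.lower h.upper δ) := by
  constructor
  · intro hzfr
    have hzA : z ∉ A := fun hzA ↦ by
      have := h.mem_interior_arcHull_of_mem hδ ⟨hzA, hz⟩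
      rw [frontier, Set.mem_sdiff] at hzfr
      exact hzfr.2 this
    have hzU : z ∈ upperHalfPlaneSet \ A := ⟨hz, hzA⟩
    refine ⟨hzA, ?_⟩
    rw [frontier_eq_closure_inter_closure] at hzfr ⊢
    have hzJ : z ∈ h.arcHull δ := by
      have := hzfr.1; rwa [h.isClosed_arcHull.closure_eq] at this
    refine ⟨subset_closure (h.ext_mem_stadium_of_mem_arcHull hzU hzJ), ?_⟩
    -- `E z ∈ closure (D_δᶜ)` by continuity of `E` along `E_δᶜ ∩ ℍ ∖ A`
    have hcont : ContinuousAt h.ext z := (h.differentiableAt_ext (h.diff_subset_slitDomain hzU)).continuousAt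
    have hzcl : z ∈ closure ((h.arcHull δ)ᶜ ∩ (upperHalfPlaneSet \ A)) := by
      have hopen : IsOpen (upperHalfPlaneSet \ A) := h.isOpen_diff
      have := hopen.inter_closure ⟨hzU, hzfr.2⟩
      rwa [inter_comm] at this
    refine (hcont.continuousWithinAt.mem_closure_image hzcl) |> closure_mono ?_
    rintro _ ⟨w, ⟨hwJ, hwU⟩, rfl⟩
    exact fun hEw ↦ hwJ (h.mem_arcHull_of_mem_core hwU hEw)
  · rintro ⟨hzA, hEfr⟩
    have hzU : z ∈ upperHalfPlaneSet \ A := ⟨hz, hzA⟩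
    rw [frontier_eq_closure_inter_closure] at hEfr ⊢
    have hED : h.ext z ∈ stadium h.lower h.upper δ := by
      have := hEfr.1; rwa [isClosed_stadium.closure_eq] at this
    refine ⟨subset_closure (h.mem_arcHull_of_mem_core hzU hED), ?_⟩
    -- `z ∈ closure (E_δᶜ)` by continuity of `Φ_A⁻¹` along `D_δᶜ ∩ ℍ`
    have hw : h.ext z ∈ upperHalfPlaneSet := h.mapsTo_ext hzU
    have hcont : ContinuousAt h.restrictionMap.symm (h.ext z) :=
      (h.restrictionMap.symm.differentiableOn_coe.differentiableAt (isOpen_upperHalfPlaneSet.mem_nhds hw)).continuousAt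
    have hwcl : h.ext z ∈ closure ((stadium h.lower h.upper δ)ᶜ ∩ upperHalfPlaneSet) := by
      have := isOpen_upperHalfPlaneSet.inter_closure ⟨hw, hEfr.2⟩
      rwa [inter_comm] at this
    have hsymm : h.restrictionMap.symm (h.ext z) = z := by
      have := h.restrictionMap.symm_apply_apply hzU; rwa [restrictionMap_apply] at this
    have key := hcont.continuousWithinAt.mem_closure_image hwcl
    rw [hsymm] at key
    refine closure_mono ?_ key
    rintro _ ⟨v, ⟨hvD, hvH⟩, rfl⟩
    intro hvJ
    have hvU := h.symm_mem hvH
    have := h.ext_mem_stadium_of_mem_arcHull hvU hvJ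
    rw [h.ext_symm_apply hvH] at this
    exact hvD this

/-- **`E_δ` is a smooth hull**: its frontier in `ℍ` is the open arc `γ(0,1)`, `γ = E⁻¹ ∘ ∂D_δ`,
continuous and injective on `[0, 1]` with real endpoints ([LSW] p. 13: "`∂E_δ ∩ ℍ̄` is a simple
path `β : [0, s] → ℍ̄` with `β(0), β(s) ∈ ℝ`"). [cite: LawlerSchrammWerner2003Restriction, proof of Lemma 3.5 (p. 13, ∂E_δ ∩ ℍ̄ is a simple path)] -/
theorem isArcHull_arcHull {δ : ℝ} (hδ : 0 < δ) (hδl : 2 * δ < h.lower) :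
    IsArcHull (h.arcHull δ) := by
  refine ⟨(h.isStarHull_arcHull hδ hδl).isBoundedHull, h.hullArc δ, h.continuousOn_hullArc hδ,
    h.injOn_hullArc hδ, h.hullArc_zero_im hδ, h.hullArc_one_im hδ, fun t ht ↦ (h.hullArc_mem_of_mem_Ioo hδ ht).1, ?_⟩
  ext z
  constructor
  · rintro ⟨hzH, hzfr⟩
    obtain ⟨hzA, hEfr⟩ := (h.mem_frontier_arcHull_iff hδ hzH).1 hzfr
    have hw : h.ext z ∈ upperHalfPlaneSet ∩ frontier (stadium h.lower h.upper δ) := ⟨h.mapsTo_ext ⟨hzH, hzA⟩, hEfr⟩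
    rw [upperHalfPlaneSet_inter_frontier_stadium h.lower_le_upper hδ] at hw
    obtain ⟨t, ht, hteq⟩ := hw
    refine ⟨t, ht, ?_⟩
    rw [hullArc, hteq, h.invExt_ext (h.diff_subset_slitDomain ⟨hzH, hzA⟩)]
  · rintro ⟨t, ht, rfl⟩
    have hU := h.hullArc_mem_of_mem_Ioo hδ ht
    refine ⟨hU.1, (h.mem_frontier_arcHull_iff hδ hU.1).2 ⟨hU.2, ?_⟩⟩
    have hw := stadiumArc_im_pos h.lower_le_upper hδ ht
    have : h.ext (h.hullArc δ t) = stadiumArc h.lower h.upper δ t := by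
      rw [hullArc]; exact h.ext_invExt (h.upperHalfPlaneSet_subset_image_ext hw)
    rw [this]
    have hmem : stadiumArc h.lower h.upper δ t ∈ upperHalfPlaneSet ∩ frontier (stadium h.lower h.upper δ) := by
      rw [upperHalfPlaneSet_inter_frontier_stadium h.lower_le_upper hδ]; exact ⟨t, ht, rfl⟩
    exact hmem.2

/-! ### The approximating sequence and its intersection -/

/-- The thicknesses `δ_n = ℓ₋ / (2(n+2)) ↓ 0`. [folklore] -/
def deltaSeq (n : ℕ) : ℝ := h.lower / (2 * ((n : ℝ) + 2))

/-- `δ_n > 0`. [folklore] -/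
theorem deltaSeq_pos (h0 : 0 < min p q) (n : ℕ) : 0 < h.deltaSeq n := by
  have := h.lower_pos h0
  unfold deltaSeq; positivity

/-- `2 δ_n < ℓ₋`. [folklore] -/
theorem two_mul_deltaSeq_lt (h0 : 0 < min p q) (n : ℕ) : 2 * h.deltaSeq n < h.lower := by
  have hl := h.lower_pos h0
  unfold deltaSeq
  rw [show 2 * (h.lower / (2 * ((n : ℝ) + 2))) = h.lower / ((n : ℝ) + 2) by field_simp,
    div_lt_iff₀ (by positivity)]
  nlinarith [n.cast_nonneg (α := ℝ)]

/-- `δ_n` decreases (when `ℓ₋ > 0`). [folklore] -/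
theorem deltaSeq_antitone : Antitone h.deltaSeq ∨ h.lower ≤ 0 := by
  by_cases hl : 0 < h.lower
  · refine Or.inl (antitone_nat_of_succ_le fun n ↦ ?_)
    unfold deltaSeq
    push_cast
    exact div_le_div_of_nonneg_left hl.le (by positivity) (by nlinarith)
  · exact Or.inr (not_lt.1 hl)

/-- `δ_n → 0`. [folklore] -/
theorem tendsto_deltaSeq : Tendsto h.deltaSeq atTop (𝓝 0) := by
  unfold deltaSeq
  have h1 : Tendsto (fun n : ℕ ↦ 2 * ((n : ℝ) + 2)) atTop atTop :=
    (tendsto_atTop_add_const_right _ 2 tendsto_natCast_atTop_atTop).const_mul_atTop two_pos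
  exact tendsto_const_nhds.div_atTop h1

/-- The filling `F = A ∪ [p, q]` — the intersection of the hulls `E_δ`. [folklore] -/
def filling (A : Set ℂ) (p q : ℝ) : Set ℂ := A ∪ realSeg p q

omit h in
/-- `A ⊆ F`. [folklore] -/
theorem subset_filling : A ⊆ filling A p q := subset_union_left

omit h in
/-- `F ∩ ℍ ⊆ A`. [folklore] -/
theorem filling_inter_subset : filling A p q ∩ upperHalfPlaneSet ⊆ A := by
  rintro z ⟨hz | hz, hzH⟩
  · exact hz
  · exact absurd (im_eq_zero_of_mem_realSeg hz) (ne_of_gt hzH)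

/-- `0 ∉ F`. [folklore] -/
theorem zero_notMem_filling : (0 : ℂ) ∉ filling A p q := by
  rintro (hz | hz)
  · exact h.isStarHull.zero_notMem hz
  · rw [show (0 : ℂ) = ((0 : ℝ) : ℂ) from rfl, ofReal_mem_realSeg] at hz
    exact h.zero_notMem_uIcc hz

/-- **Points of the slit `[p, q]` lie in every `E_δ`** (the uniform cluster lemma along the
vertical approach). [folklore] -/
theorem ofReal_mem_arcHull {δ : ℝ} (hδ : 0 < δ) {x : ℝ} (hx : x ∈ uIcc p q) : (x : ℂ) ∈ h.arcHull δ := by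
  by_cases hxA : (x : ℂ) ∈ A
  · exact h.subset_arcHull hxA
  have hxΩ : (x : ℂ) ∉ slitDomain A p q := fun hΩ ↦ (h.ofReal_mem_slitDomain_iff.1 hΩ) hx
  obtain ⟨r, hr, hrS⟩ := h.exists_forall_infDist_ext_lt hxΩ hδ
  obtain ⟨r', hr', hball⟩ := Metric.isOpen_iff.1 h.isClosed_A.isOpen_compl _ hxA
  -- vertical approach
  have hpath : Tendsto (fun s : ℝ ↦ (x : ℂ) + s * I) (𝓝[>] 0) (𝓝 (x : ℂ)) := by
    have : Continuous fun s : ℝ ↦ (x : ℂ) + s * I := by fun_prop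
    simpa using (this.tendsto 0).mono_left nhdsWithin_le_nhds
  rw [← h.isClosed_arcHull.closure_eq]
  refine mem_closure_of_tendsto hpath ?_
  have hev : ∀ᶠ s : ℝ in 𝓝[>] 0, s < min r r' := nhdsWithin_le_nhds (Iio_mem_nhds (lt_min hr hr'))
  filter_upwards [self_mem_nhdsWithin, hev] with s hs hsr
  have hs0 : 0 < s := hs
  have hdist : dist ((x : ℂ) + s * I) x = s := by
    rw [dist_eq_norm, add_sub_cancel_left, norm_mul, norm_real, norm_I, mul_one, Real.norm_of_nonneg hs0.le]
  have hwU : (x : ℂ) + s * I ∈ upperHalfPlaneSet \ A := by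
    refine ⟨show 0 < ((x : ℂ) + s * I).im by simp; exact hs0, fun hA ↦ hball ?_ hA⟩
    rw [mem_ball, hdist]; exact hsr.trans_le (min_le_right _ _)
  refine h.mem_arcHull_of_mem_core hwU ⟨(h.mapsTo_ext hwU).le, ?_⟩
  exact (hrS _ hwU (by rw [hdist]; exact hsr.trans_le (min_le_left _ _))).le

/-- **`⋂ₙ E_{δ_n} = A ∪ [p, q]`.** [folklore] -/
theorem iInter_arcHull (h0 : 0 < min p q) : (⋂ n, h.arcHull (h.deltaSeq n)) = filling A p q := by
  apply Subset.antisymm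
  · intro z hz
    rw [mem_iInter] at hz
    rcases lt_trichotomy z.im 0 with hlt | heq | hgt
    · exact absurd ((h.isStarHull_arcHull (h.deltaSeq_pos h0 0) (h.two_mul_deltaSeq_lt h0 0)).isBoundedHull.im_nonneg (hz 0))
        (not_le.2 hlt)
    · -- a real point: in `A`, in the slit, or in `Ω`
      have hzre : ((z.re : ℝ) : ℂ) = z := Complex.ext (by simp) (by simp [heq])
      by_cases hzA : z ∈ A
      · exact Or.inl hzA
      by_cases hzI : z.re ∈ uIcc p q
      · exact Or.inr (hzre ▸ ofReal_mem_realSeg.2 hzI)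
      exfalso
      have hzΩ : z ∈ slitDomain A p q := hzre ▸ (h.ofReal_mem_slitDomain_iff).2 hzI
      -- `E z` is a real point off `[ℓ₋, ℓ₊]`, at positive distance `d₀`
      have hEnot : h.ext z ∉ realSeg h.lower h.upper := by
        rw [← hzre, h.ext_ofReal_eq (hzre.symm ▸ hzΩ), ofReal_mem_realSeg, uIcc_of_le h.lower_le_upper]
        exact h.extRe_notMem_Icc (hzre.symm ▸ hzΩ)
      have hd₀ : 0 < infDist (h.ext z) (realSeg h.lower h.upper) :=
        (isCompact_realSeg.isClosed.notMem_iff_infDist_pos (realSeg_nonempty _ _)).1 hEnot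
      obtain ⟨n, hn⟩ := ((tendsto_order.1 h.tendsto_deltaSeq).2 _ hd₀).exists
      -- `z ∈ closure (core_n)` with `E` continuous at `z` forces `infDist (E z) ≤ δ_n`
      have hzJ := hz n
      have hcl : z ∈ closure (A ∩ upperHalfPlaneSet) ∪
          closure {w | w ∈ upperHalfPlaneSet \ A ∧ h.ext w ∈ stadium h.lower h.upper (h.deltaSeq n)} := by
        rw [← closure_union, ← h.arcHull_inter, h.closure_arcHull_inter]; exact hzJ
      rcases hcl with hcl | hcl
      · rw [h.isStarHull.isBoundedHull.closure_inter_eq] at hcl; exact hzA hcl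
      · have hcont : ContinuousAt h.ext z := (h.differentiableAt_ext hzΩ).continuousAt
        have hmem := hcont.continuousWithinAt.mem_closure_image hcl
        have hsub : h.ext '' {w | w ∈ upperHalfPlaneSet \ A ∧ h.ext w ∈ stadium h.lower h.upper (h.deltaSeq n)} ⊆
            stadium h.lower h.upper (h.deltaSeq n) := by rintro _ ⟨w, hw, rfl⟩; exact hw.2
        have := closure_minimal hsub isClosed_stadium hmem
        linarith [this.2]
    · by_cases hzA : z ∈ A
      · exact Or.inl hzA
      exfalso
      have hzU : z ∈ upperHalfPlaneSet \ A := ⟨hgt, hzA⟩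
      have hE : ∀ n, infDist (h.ext z) (realSeg h.lower h.upper) ≤ h.deltaSeq n := fun n ↦
        (h.ext_mem_stadium_of_mem_arcHull hzU (hz n)).2
      have h0d : infDist (h.ext z) (realSeg h.lower h.upper) = 0 :=
        le_antisymm (ge_of_tendsto' h.tendsto_deltaSeq hE) infDist_nonneg
      have hmem : h.ext z ∈ realSeg h.lower h.upper := by
        rw [← isCompact_realSeg.isClosed.closure_eq, mem_closure_iff_infDist_zero (realSeg_nonempty _ _)]
        exact h0d
      have := im_eq_zero_of_mem_realSeg hmem
      exact absurd this (ne_of_gt (h.mapsTo_ext hzU))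
  · rintro z (hz | hz)
    · exact mem_iInter.2 fun n ↦ h.subset_arcHull hz
    · obtain ⟨x, hx, rfl⟩ := hz
      exact mem_iInter.2 fun n ↦ h.ofReal_mem_arcHull (h.deltaSeq_pos h0 n) hx

/-! ### Convergence of the restriction maps -/

/-- **`Φ_{E_δₙ} → Φ_A` uniformly on every `S ⊆ ℍ` with compact closure missing `A ∪ [p, q]`**:
`Φ_{E_δ} = Φ_{D_δ} ∘ Φ_A` (uniqueness of restriction maps), `E(closure S)` is a compact missing
`[ℓ₋, ℓ₊]`, and `Φ_{D_δ} → id` uniformly there (`exists_forall_norm_stadium_ext_sub_le`). [folklore] -/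
theorem tendstoUniformlyOn_arcHull (h0 : 0 < min p q)
    {Φ' : ConformalEquiv (upperHalfPlaneSet \ A) upperHalfPlaneSet}
    {Ψ : ∀ n, ConformalEquiv (upperHalfPlaneSet \ h.arcHull (h.deltaSeq n)) upperHalfPlaneSet}
    (hΦ' : IsRestrictionMap A Φ') (hΨ : ∀ n, IsRestrictionMap (h.arcHull (h.deltaSeq n)) (Ψ n))
    {S : Set ℂ} (hS : S ⊆ upperHalfPlaneSet) (hScpt : IsCompact (closure S))
    (hSF : Disjoint (closure S) (filling A p q)) :
    TendstoUniformlyOn (fun n z ↦ Ψ n z) (fun z ↦ Φ' z) atTop S := by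
  -- `closure S ⊆ Ω`
  have hclH : closure S ⊆ {z : ℂ | 0 ≤ z.im} := by
    rw [← closure_setOf_lt_im]; exact closure_mono hS
  have hclΩ : closure S ⊆ slitDomain A p q := fun z hz ↦ by
    have hzF : z ∉ filling A p q := fun hzF ↦ Set.disjoint_left.1 hSF hz hzF
    rcases (show 0 ≤ z.im from hclH hz).lt_or_eq with hlt | heq
    · exact (h.mem_slitDomain_iff_of_im_pos hlt).2 fun hzA ↦ hzF (Or.inl hzA)
    · have hzre : ((z.re : ℝ) : ℂ) = z := Complex.ext (by simp) (by simp [heq.symm])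
      rw [← hzre, h.ofReal_mem_slitDomain_iff]
      exact fun hzI ↦ hzF (Or.inr (hzre ▸ ofReal_mem_realSeg.2 hzI))
  -- the compact `K = E(closure S)` misses `[ℓ₋, ℓ₊]`
  set K : Set ℂ := h.ext '' closure S with hK
  have hKcpt : IsCompact K := hScpt.image_of_continuousOn (h.continuousOn_ext.mono hclΩ)
  have hKdisj : Disjoint K (realSeg h.lower h.upper) := by
    refine Set.disjoint_left.2 ?_
    rintro _ ⟨z, hz, rfl⟩ hmem
    have hzΩ := hclΩ hz
    rcases (show 0 ≤ z.im from hclH hz).lt_or_eq with hlt | heq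
    · have hzA : z ∉ A := fun hzA ↦ Set.disjoint_left.1 hSF hz (Or.inl hzA)
      exact absurd (im_eq_zero_of_mem_realSeg hmem) (ne_of_gt (h.mapsTo_ext ⟨hlt, hzA⟩))
    · have hzre : ((z.re : ℝ) : ℂ) = z := Complex.ext (by simp) (by simp [heq.symm])
      rw [← hzre, h.ext_ofReal_eq (hzre.symm ▸ hzΩ), ofReal_mem_realSeg, uIcc_of_le h.lower_le_upper] at hmem
      exact h.extRe_notMem_Icc (hzre.symm ▸ hzΩ) hmem
  -- positive distance from `K` to the segment
  obtain ⟨d, hd0, hd⟩ : ∃ d > 0, ∀ w ∈ K, d ≤ infDist w (realSeg h.lower h.upper) := by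
    rcases K.eq_empty_or_nonempty with hKe | hKne
    · exact ⟨1, one_pos, by simp [hKe]⟩
    obtain ⟨w₀, hw₀, hmin⟩ := hKcpt.exists_isMinOn hKne (continuous_infDist_pt _).continuousOn
    refine ⟨_, ?_, fun w hw ↦ hmin hw⟩
    exact (isCompact_realSeg.isClosed.notMem_iff_infDist_pos (realSeg_nonempty _ _)).1
      fun hmem ↦ Set.disjoint_left.1 hKdisj hw₀ hmem
  -- the flat estimate on `K`
  obtain ⟨C, δ₀, hδ₀, hδ₀l, hflat⟩ :=
    exists_forall_norm_stadium_ext_sub_le (h.lower_pos h0) h.lower_le_upper hKcpt hKdisj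
  rw [Metric.tendstoUniformlyOn_iff]
  intro ε hε
  have hev1 : ∀ᶠ n in atTop, h.deltaSeq n < min δ₀ d :=
    (tendsto_order.1 h.tendsto_deltaSeq).2 _ (lt_min hδ₀ hd0)
  have hev2 : ∀ᶠ n in atTop, (max C 0 + 1) * h.deltaSeq n < ε := by
    have := (h.tendsto_deltaSeq.const_mul (max C 0 + 1))
    rw [mul_zero] at this
    exact (tendsto_order.1 this).2 ε hε
  filter_upwards [hev1, hev2] with n hn1 hn2
  have hδn := h.deltaSeq_pos h0 n
  have hδnl := h.two_mul_deltaSeq_lt h0 n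
  have hδn₀ : h.deltaSeq n < δ₀ := hn1.trans_le (min_le_left _ _)
  have hδnd : h.deltaSeq n < d := hn1.trans_le (min_le_right _ _)
  set hD := h.isSlitHull_stadium_lower_upper hδn hδnl
  -- `Ψ n = Φ_{D_n} ∘ Φ_A` on `ℍ ∖ E_n`
  have hPM : IsRestrictionMap (h.arcHull (h.deltaSeq n))
      (hullProductMap hD.restrictionMap h.restrictionMap isClosed_stadium h.isClosed_A) :=
    IsRestrictionMap.hullProduct isClosed_stadium h.isClosed_A hD.isRestrictionMap h.isRestrictionMap
  obtain ⟨Φ₀, -, huniq⟩ := IsStarHull.existsUnique_isRestrictionMap_holds (h.isStarHull_arcHull hδn hδnl)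
  intro z hz
  have hzcl : z ∈ closure S := subset_closure hz
  have hzU : z ∈ upperHalfPlaneSet \ A := ⟨hS hz, fun hzA ↦ Set.disjoint_left.1 hSF hzcl (Or.inl hzA)⟩
  have hwK : h.ext z ∈ K := ⟨z, hzcl, rfl⟩
  -- `z ∉ E_n`
  have hzJ : z ∉ h.arcHull (h.deltaSeq n) := fun hzJ ↦ by
    have := (h.ext_mem_stadium_of_mem_arcHull hzU hzJ).2
    linarith [hd _ hwK]
  have hzV : z ∈ upperHalfPlaneSet \ h.arcHull (h.deltaSeq n) := ⟨hzU.1, hzJ⟩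
  have hΨz : Ψ n z = hD.ext (h.ext z) := by
    rw [huniq (Ψ n) (hΨ n) hzV, ← huniq _ hPM hzV, hullProductMap_apply, hD.restrictionMap_apply,
      h.restrictionMap_apply]
  have hΦz : Φ' z = h.ext z := by rw [h.eqOn_restrictionMap hΦ' hzU, h.restrictionMap_apply]
  rw [hΨz, hΦz, dist_comm, dist_eq_norm]
  calc ‖hD.ext (h.ext z) - h.ext z‖ ≤ C * h.deltaSeq n := hflat _ hδn hδnl hδn₀ _ hwK
    _ ≤ (max C 0 + 1) * h.deltaSeq n := by nlinarith [le_max_left C 0]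
    _ < ε := hn2

/-! ### The packaged outer approximation -/

/-- **Outer approximation of a one-sided hull on the positive axis by smooth hulls**
(`HasArcApprox A`), with `J n = E_{δ_n}` and `F = A ∪ [p, q]`. [cite: LawlerSchrammWerner2003Restriction, Lemma 2.1 (p. 8) with the proof of Lemma 3.5 (p. 13)] -/
theorem hasArcApprox (h0 : 0 < min p q) : HasArcApprox A := by
  have hanti : Antitone fun n ↦ h.arcHull (h.deltaSeq n) := by
    rcases h.deltaSeq_antitone with hm | hle
    · exact fun m n hmn ↦ h.arcHull_mono (hm hmn)
    · exact absurd (h.lower_pos h0) (not_lt.2 hle)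
  exact ⟨fun n ↦ h.arcHull (h.deltaSeq n), filling A p q,
    fun n ↦ h.isArcHull_arcHull (h.deltaSeq_pos h0 n) (h.two_mul_deltaSeq_lt h0 n),
    fun n ↦ h.isStarHull_arcHull (h.deltaSeq_pos h0 n) (h.two_mul_deltaSeq_lt h0 n),
    hanti, h.iInter_arcHull h0, subset_filling, filling_inter_subset, h.zero_notMem_filling,
    fun Φ' Ψ hΦ' hΨ S hS hScpt hSF ↦ h.tendstoUniformlyOn_arcHull h0 hΦ' hΨ hS hScpt hSF⟩

end IsSlitHull

/-- **[LSW] Lemma 2.1 (outer approximation with convergence) for nonempty `A ∈ 𝒬₊`, PROVED.**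
[cite: LawlerSchrammWerner2003Restriction, Lemma 2.1 (p. 8)] -/
theorem IsPlusHull.hasArcApprox' {A : Set ℂ} (hA : IsPlusHull A) (hne : A.Nonempty) : HasArcApprox A := by
  have h := hA.isSlitHull hne
  refine h.hasArcApprox ?_
  have hT : IsCompact (realTrace A) := isCompact_realTrace hA.1.isBoundedHull.isCompact
  have hTne : (realTrace A).Nonempty := hA.1.isBoundedHull.realTrace_nonempty hne
  have hm : sInf (realTrace A) ∈ realTrace A := hT.sInf_mem hTne
  have hm0 : 0 < sInf (realTrace A) := hA.2 _ hm
  have hmM : sInf (realTrace A) ≤ sSup (realTrace A) := le_csSup hT.bddAbove hm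
  exact lt_min (by linarith) (by linarith)

/-- **[LSW] Lemma 2.1 for nonempty `A ∈ 𝒬₋`, PROVED** by the reflection `σ` (as throughout
[LSW] §3, "by symmetry"): approximate `σ(A) ∈ 𝒬₊`, reflect the hulls and the filling back, and
transport the convergence through `Φ_{σ(B)} = σ ∘ Φ_B ∘ σ`.
[cite: LawlerSchrammWerner2003Restriction, Lemma 2.1 (p. 8) with §2 p. 8 (𝒬₋ = σ(𝒬₊))] -/
theorem IsMinusHull.hasArcApprox' {A : Set ℂ} (hA : IsMinusHull A) (hne : A.Nonempty) : HasArcApprox A := by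
  obtain ⟨J, F₀, hJa, hJs, hJm, hJi, hAF, hFA, h0F, hconv⟩ := (hA.image_imagAxisRefl).hasArcApprox' (hne.image _)
  have hAc : IsClosed A := hA.1.isBoundedHull.isClosed
  have hJc : ∀ n, IsClosed (imagAxisRefl '' J n) := fun n ↦
    (hJs n).image_imagAxisRefl.isBoundedHull.isClosed
  refine ⟨fun n ↦ imagAxisRefl '' J n, imagAxisRefl '' F₀, fun n ↦ (hJa n).image_imagAxisRefl,
    fun n ↦ (hJs n).image_imagAxisRefl, fun m n hmn ↦ image_mono (hJm hmn), ?_, ?_, ?_, ?_, ?_⟩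
  · rw [← image_iInter imagAxisRefl.bijective, hJi]
  · conv_lhs => rw [← imagAxisRefl_image_image A]
    exact image_mono hAF
  · rintro z ⟨⟨w, hw, rfl⟩, hzH⟩
    have hwH : w ∈ upperHalfPlaneSet := by simpa [upperHalfPlaneSet] using hzH
    have hwA : w ∈ imagAxisRefl '' A := hFA ⟨hw, hwH⟩
    rw [← imagAxisRefl_image_image A]
    exact mem_image_of_mem _ hwA
  · rintro ⟨w, hw, hw0⟩
    have : w = 0 := by simpa using congrArg imagAxisRefl hw0
    rw [this] at hw
    exact h0F hw
  · intro Φ Ψ hΦ hΨ S hS hScpt hSF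
    have hΦ' := hΦ.reflectHull hAc
    have hΨ' := fun n ↦ ((hΨ n).reflectHull (hJc n)).of_eq (imagAxisRefl_image_image (J n))
    have key := hconv _ _ hΦ' hΨ' (imagAxisRefl '' S)
      (by rw [← imagAxisRefl_image_upperHalfPlaneSet]; exact image_mono hS)
      (by rw [← imagAxisRefl.image_closure]; exact hScpt.image imagAxisRefl.continuous)
      (by rw [← imagAxisRefl.image_closure, ← imagAxisRefl_image_image F₀]
          exact (Set.disjoint_image_iff imagAxisRefl.injective).2 hSF)
    refine tendstoUniformlyOn_of_imagAxisRefl ?_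
    refine key.congr ?_ |>.congr_right ?_
    · exact Eventually.of_forall fun n ↦ fun z _ ↦ rfl
    · intro z _; rfl

/-- **Outer approximation by smooth `*`-hulls, with convergence, for nonempty `A ∈ 𝒬₊ ∪ 𝒬₋` —
PROVED** (no appeal to the named fact `IsPlusHull.exists_antitone_isArcHull`).
[cite: LawlerSchrammWerner2003Restriction, Lemma 2.1 (p. 8)] -/
theorem hasArcApprox_of_plus_or_minus' {A : Set ℂ} (hA : IsPlusHull A ∨ IsMinusHull A) (hne : A.Nonempty) :
    HasArcApprox A :=
  hA.elim (fun h ↦ h.hasArcApprox' hne) (fun h ↦ h.hasArcApprox' hne)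

end Literature.Probability.RandomPlanarGeometry
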